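import Literature.MathematicalPhysics.QuantumFieldTheory.Balaban1983to89.B13Lemma1BlocksTorus
import Literature.MathematicalPhysics.QuantumFieldTheory.Balaban1983to89.B13LeafTorus
import Literature.MathematicalPhysics.QuantumFieldTheory.Balaban1983to89.B13Lemma2Torus
import Literature.MathematicalPhysics.QuantumFieldTheory.Balaban1983to89.B13Lemma3TorusSocket
import Literature.MathematicalPhysics.QuantumFieldTheory.Balaban1983to89.B13Lemma3TorusBinders

/-!
# `Balaban1983to89.B13NodeTorusTermwise` — T. Bałaban, *Renormalization group approach to lattice gauge field theories.
II. Cluster expansions*, Commun. Math. Phys. **116** (1988) 1–22, doi:10.1007/bf01239022 [Balaban1988RG2Cluster]: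
**the DAG node N10 `Dag.B13_main` («b9 → b10 → b11 → b12 → b13») ON THE TWO-SCALE TORUS WITH NO LEAF CONJUNCT ENTERING
AS TYPED** — Lemma 1 from its located per-term inputs with [I]'s block geometry concrete
(`B13Lemma1BlocksTorus.lemma1Printed_twoTorus_blocks`), Lemma 2 from its located per-term inputs with V″_k = V′_k + the
local pieces of P^{(k)} (`B13Lemma2Torus.lemma2Printed_twoTorus'`, `bound136_of_split`: (1.42)/(1.43) PROVED, (1.36)
for V″_k PROVED from Lemma 1 at reduced constant + the local sizes), Lemma 3 = (2.38) from (2.26) PER TERM + termwise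
domination + the restrictions on the constants (`B13Lemma3TorusSocket.hRep_of_termwise` → `bound238With_of_hRep`, every
resummation / geometric / combinatorial step of pp. 17–20 kernel-checked on the papers' periodic carrier) — and one
level lower, (2.26) per term from the PRIMITIVE objects (`B13Lemma3TorusBinders.h226_torus_of_primitives_of_lemma2`,
its Lemma-2 binders discharged inside) — knitted by `B13LeafTorus.b13_main_of_leaf`

statement-level skeleton of published theorems with citation tags; proofs where landed; nothing here is a claim about
the Yang–Mills mass gap

PDF held: `paper:balaban1988-cmp116-rg-ii-cluster` (journal page = PDF page + 0); pp. 14, 15, 17 re-read this session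
(text layer `p0014.txt`, `p0015.txt`, `p0017.txt` + the render of p. 17,
`run/shared/lean/pub/pub-balaban/b2b-balaban-ref1/pages/1988-cmp116-rg-II-cluster/1988-cmp116-rg-II-cluster-p017-x2.png`);
the Lemma 1/2/3 sentences of pp. 9, 11, 20 are the tree's verbatim quotations (`B13.Lemma1Printed`, `B13.Lemma2Printed`,
`B13.Lemma3Printed`).

CITATION HEADER (verbatim).  p. 9 [PDF 9] Lemma 1: *"For each term in the sum there exists a function V′_k(Y, 𝐔, 𝐉, B),
defined and analytic on the space (1.34) … There exist absolute constants C₁, C₂, q, for which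
|V′_k(Y, 𝐔, 𝐉, B)| ≦ E₀ε₁C₁M^q exp C₂κ₁ exp(−(1 − 2δ)κd_k(Y)). (1.36)"*; p. 11 [PDF 11] Lemma 2: *"This function is a
sum of two terms V_k(Y, B) = ½⟨Q(Y, B)B, B⟩ + V″_k(Y, B). (1.42) … |Q(Y, B, b, b′)| ≦ C₃ε₁M⁴ exp C₂κ₁ exp(−⅛(κ₁ −
1)d_k(Y) − ½(κ₁ − 1)M⁻⁴|Y|), (1.43) and the function V″_k(Y, B) satisfies the bound (1.36)"*; p. 14 [PDF 14]:
*"(2.1) = Σ_Z H(Z), where H(Z) = Σ_{Z₀: Z₀ᶜ = Z} H(Z, Z₀). (2.9) This is the desired expansion into localized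
quantities. … The activities H(Z) are sums of many terms, more exactly the sums in (2.9), (2.1), (2.3) over Z₀, 𝐃,
P."*; p. 15 [PDF 15]: *"To get a bound for H(Z) we consider a term in the sum over 𝐃, P. This term can be written in
the following form: … (2.14) … We consider it as an analytic function of (U, J) in the space U^c_{k+1}(X, α₀, α₁), and
of the complex parameters σ(Z), τ."*; p. 17 [PDF 17] (render `…-p017-x2.png`; the text layer drops the display): *"This
ends the estimate of the expression (2.14). Gathering together all the bounds we get |(2.14)| ≦ exp(−(κ₁ −
1)(LM)⁻⁴|Z∖Z′₀|)·[Π_{Y∈𝐃} 2E₀ε₁C₁α₄⁻¹M^q exp C₂κ₁ exp(−(1 − 3δ)κd_k(Y))] exp(−½γ₂(ε₁²/g_k²)|P|)·exp O(1)α₅|Z|.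
(2.26) … To get a bound for H(Z) we have to perform the resummation of the terms (2.14) over 𝐃, P and Z₀. We do it
in the following order. For a fixed Y₀ we sum over all 𝐃 satisfying (2.2). Next, we sum over Y₀, P determining a
fixed Z₀. Further, for a fixed Z′₀, we sum over all possible Z₀ determining this fixed Z′₀. Finally we sum over all
Z′₀ ⊂ Z."*; p. 20 [PDF 20] Lemma 3: *"Under all the above restrictions on the constants M, κ, κ₁, α₀, α₁, α₄, α₆, γ₂,
γ, ε₁, the activity H(Z) for a localization domain Z ∈ 𝐃_{k+1} satisfies the inequality |H(Z)| ≦ C₃ε₁ exp(−(1 −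
8δ)½Lκd_{k+1}(Z)). (2.38)"*.

WHAT IS REPRODUCED (cell `pub-ymgap`, HUMAN RULING D-0062 Track A, DAG node N10 = [B13], prover seat
`pub-ymgap-dag-p2` = n10-a (KNIT-BY-NAME), generation g3; a NEW LEAF over `B13Lemma1BlocksTorus`, `B13LeafTorus` (n10-a),
`B13Lemma2Torus` v1.1 (n10-b, p409133/p411194), `B13Lemma3TorusSocket` (lit-balaban r10 lineage) and
`B13Lemma3TorusBinders` (n10-b, p410704), nothing there modified).  The previous knit
`B13NodeTorus.b13_main_twoTorus_located(_of_226)` (p409536) still took the Lemma-2 conjuncts of the record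
`hrepr : B13.Repr142`, `h143 : B13.Bound143`, `hVan` AS TYPED, read V″_k := V′_k, and took Lemma 3 through the
RESUMMED majorant `hrep`.  THIS FILE (the «KNIT v2» of the seat's handoff; n10-b's [DAGN10B-G0-KNIT-RECIPE-1] (A)+(B)
with the v1.1 update «prefer `lemma2Printed_twoTorus'`»):
* §1 small numerics: `eleven_thirds_le_of_R7` (the implicit κ₁ ≥ 11/3 of the p. 11 □-sum ⇐ Lemma 1's threshold
  κ₁ ≥ 1 + 2 log(8·12³)), `binders_kappa1_of_R7`, `one_le_kappa1_of_R7`, `binders_deltaKappa_of_126` (the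
  (2.19)/(2.20) thresholds of `B13Lemma3TorusBinders` ⇐ Lemma 1's (1.32)/(1.26) thresholds), `C3_nonneg_of_floor`,
  `invTau_le_half` (|τ(Y)|⁻¹ ≤ ½ from the number `E₀ε₁C₁α₄⁻¹M^q e^{C₂κ₁} ≤ ½`);
* §2 **`lemma12_twoTorus`** — LEMMA 1 ∧ LEMMA 2 for the record `Wt.toStepData` of a two-scale torus step
  `Wt : TwoTorusStep 4 L N′` FROM LOCATED INPUTS ONLY, V″_k GENERAL: (1) Lemma 1's index data of (1.33), per-term
  analyticity, per-term (1.24)/(1.30), thresholds, R8/R9 (as in `lemma1Printed_twoTorus_blocks`), the choice `hC` of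
  C₁, C₂, q WITH HEADROOM `(1 − θ)` for the local pieces; (2) V″_k = V′_k + G (`hVpp`; G = the strictly local terms
  T1/T2 of P^{(k)} with localization domain Y, cell census G-adv9-20 (c)) with G analytic on (1.34) and of
  (1.36)-shape at prefactor θ (`hGl`), and Lemma 2's per-cube scaled cubic `1/g_k²`-terms with the (1.39)-rate, the
  coordinate reading of B on Y, the identifications `hV`/`hQ` (definitional at a pin), (1.34) in coordinates,
  `volk = #Y`, the floor, per-term analyticity, gauge invariance by assertion (as in `lemma2Printed_twoTorus'`).
  Inside: Lemma 1 at the constants `{c with E₀ := (1 − θ)E₀}` and at `c`; (1.36) for V″ by `bound136_of_split`;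
* §3 **`b13Leaf_twoTorus_termwise`** — THE B13 LEAF TRIPLE `Lemma1Printed ∧ Lemma2Printed ∧ Lemma3Printed` for
  `Wt.toStepData` from §2's inputs + Lemma 3 at LEVEL T of `B13Lemma3TorusSocket`: a term map `T₃` over the torus
  term set `terms L M₃ Z`, TERMWISE DOMINATION `TermDomination M₃ Wt T₃` ((2.9)/(2.14)), (2.26) PER TERM
  `Termwise226 c a a₅ Wt T₃`, and ONE bundle `Lemma3Numerics c M₃ (L/2) a a₂ a₂′ a₅ Aabs` of the printed restrictions
  at the printed transfer factor ℓ = ½L ((2.36) = `TreeLengthTorusGeometry236Printed.ineq236Printed_torus`, L ≥ 8);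
  **`b13_main_twoTorus_termwise`** — THE NODE `Dag.B13_main (leavesP w P)` at a binding of record
  `w.up P = Upstream.ofPrintedAllXPN X Y Z V W′` whose B13 group is `(Wt.toStepData, c)`, from the same inputs;
  `b13_main_of_leaf_twoTorus` — the node from the torus leaf triple (for pins composing by name);
* §4 **`b13Leaf_twoTorus_primitives`** — ONE LEVEL BELOW LEVEL T: the letter `h226` REPLACED, per term (𝐃, P) of every
  Z at every configuration of the space of p. 15, by the PRIMITIVE data of
  `B13Lemma3TorusBinders.h226_torus_of_primitives_of_lemma2` (the term IS the display (2.14)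
  `term214 r (Z∖Z′₀) 𝐃 (core214 A Γ (F214 |P| χ_{Y₀} χᶜ_P 𝐃 V)) 0 0`; kernels `A(σ)`, `Γ(σ)`/`G(σ)`, `C`, `Γ₀` with
  the uniform localisation «L17a» and the σ-difference bounds «L16a», the (2.3) characteristic functions, potentials
  agreeing with the record's V_k on (1.34), separate holomorphy, smallness numerics, constant matchings), its Lemma-2
  binders `hrepr`/`h143`/`h136` DISCHARGED INSIDE by §2, its thresholds κ₁ ≥ 1 + 4 log 162, δκ ≥ 64 log 162, C₃ ≥ 0,
  |τ(Y)|⁻¹ ∈ ]0, ½] DERIVED from Lemma 1's thresholds, the floor and the number `E₀ε₁C₁α₄⁻¹M^q e^{C₂κ₁} ≤ ½`.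
NO HYPOTHESIS RESTATES A LEAF CONJUNCT: (1.36), (1.42), (1.43), (1.36)-for-V″, (2.38) and the resummed (2.26)-majorant
are CONCLUSIONS of the imported torus theorems; what enters is per-term and located (Lemma 1: (1.24)/(1.30) by
reference to [13] (3.107)–(3.108), [15] Prop. 4, [I] Sect. 3; the local pieces of P^{(k)}: their size on (1.34),
`B13PkLocalTerms`; Lemma 2: the (1.38) polydisc data / [15] per term; Lemma 3: (2.26) per term in §3, the primitive
kernels of NODE O with L17a/L16a ([13] Thm 3.15 ff., k-uniform — cell GAPS G-B9-10) + termwise domination in §4), the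
identifications of a pin, and numbers.
HONEST FRAMING: a count-neutral Track-A side landing (YM-PLAN §1); NOT a discharge of node N10 — the B13 group is FREE
at NODE 00 Stages 1–3 (`Node00.CarriersFrame.carriers₁_groupB13`), the instance (Bałaban's step objects as a
`TwoTorusStep` with these per-term data) is not in the tree; one finite T⁴ programme at fixed ε; Bałaban AS PRINTED with
page locators; nothing continuum ∕ OS ∕ mass-gap ∕ Clay.  No `sorry`, no definition, no new named fact (D-0026).
-/

/- Nested operator spaces `E →L[ℂ] E →L[ℂ] ℂ` (the quadratic-form operator `B13PkScaling.Qop` in the Lemma-2 data)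
need one more level of pending instance synthesis than the default, as in `B13Lemma2Torus`. -/
set_option maxSynthPendingDepth 3

noncomputable section

namespace Literature.MathematicalPhysics.QuantumFieldTheory.Balaban1983to89.B13NodeTorusTermwise

open Metric
open Literature.MathematicalPhysics.QuantumFieldTheory.Balaban1983to89
open Literature.MathematicalPhysics.QuantumFieldTheory.Balaban1983to89.B13ScaleTransfer (Pt)
open Literature.MathematicalPhysics.QuantumFieldTheory.Balaban1983to89.B16Absorption (pbox)
open Literature.MathematicalPhysics.QuantumFieldTheory.Balaban1983to89.TreeLengthTorus
open Literature.MathematicalPhysics.QuantumFieldTheory.Balaban1983to89.TreeLengthTorusGeometry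
open Literature.MathematicalPhysics.QuantumFieldTheory.Balaban1983to89.TreeLengthTorusTransfer
  (tcoarse tclosure tclosureDom)
open Literature.MathematicalPhysics.QuantumFieldTheory.Balaban1983to89.TreeLengthTorusGeometry236Printed
  (ineq236Printed_torus)
open Literature.MathematicalPhysics.QuantumFieldTheory.Balaban1983to89.B12TreeDecay (kappa₀ K₀)
open Literature.MathematicalPhysics.QuantumFieldTheory.Balaban1983to89.B13Lemma3TorusData
open Literature.MathematicalPhysics.QuantumFieldTheory.Balaban1983to89.B13Lemma3Torus (TwoTorusStep)
open Literature.MathematicalPhysics.QuantumFieldTheory.Balaban1983to89.B13Lemma3TorusSocket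
  (TermDomination Termwise226 Lemma3Numerics hRep_of_termwise bound238With_of_hRep)
open Literature.MathematicalPhysics.QuantumFieldTheory.Balaban1983to89.B13PkScaling (Qop scaled)
open Literature.MathematicalPhysics.QuantumFieldTheory.Balaban1983to89.DagBinding
open Literature.MathematicalPhysics.QuantumFieldTheory.Balaban1983to89.B13Lemma1BlocksTorus (lemma1Printed_twoTorus_blocks)
open Literature.MathematicalPhysics.QuantumFieldTheory.Balaban1983to89.B13Lemma2Torus
  (lemma2Printed_twoTorus' bound136_of_split)
open Literature.MathematicalPhysics.QuantumFieldTheory.Balaban1983to89.B13LeafTorus (b13_main_of_leaf)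
open Literature.MathematicalPhysics.QuantumFieldTheory.Balaban1983to89.B13Bound143 (invTau invTau_pos R12)
open Literature.MathematicalPhysics.QuantumFieldTheory.Balaban1983to89.B13Term214 (term214 SepHolOn core214 F214)
open Literature.MathematicalPhysics.QuantumFieldTheory.Balaban1983to89.B13Lemma3TorusTerms (terms weight Z0)
open Literature.MathematicalPhysics.QuantumFieldTheory.Balaban1983to89.B5TorusCover (UT)
open Literature.MathematicalPhysics.QuantumFieldTheory.Balaban1983to89.B9Thm37GlueTorus (tdist1)
open Literature.MathematicalPhysics.QuantumFieldTheory.Balaban1983to89.B13Lemma3TorusBinders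
  (h226_torus_of_primitives_of_lemma2)

/-! ## §1. Small numerics: thresholds of the cited modules subsumed by Lemma 1's -/

/-- The □-sum of p. 11 l. 1–4 (`B13Lemma2Torus.qsum_rate_le`) uses κ₁ ≥ 11/3; Lemma 1's (1.27) threshold
κ₁ ≥ 1 + 2 log(8·12³) already gives it (e² < 8·12³).  Elementary. [cite: Balaban1988RG2Cluster, (1.27) p.8 and p.11 l.1–4] -/
theorem eleven_thirds_le_of_R7 {κ₁ : ℝ} (h : 1 + 2 * Real.log (8 * 12 ^ 3) ≤ κ₁) : 11 / 3 ≤ κ₁ := by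
  have h2 : (2 : ℝ) ≤ Real.log (8 * 12 ^ 3) := by
    rw [Real.le_log_iff_exp_le (by norm_num)]
    have h1 := Real.exp_one_lt_d9
    have h0 := Real.exp_pos 1
    have : Real.exp 2 = Real.exp 1 * Real.exp 1 := by rw [← Real.exp_add]; norm_num
    rw [this]
    nlinarith
  linarith

/-- The (2.19)/(2.20) threshold κ₁ ≥ 1 + 4 log 162 of `B13Lemma3TorusBinders` follows from Lemma 1's (1.32) threshold
κ₁ ≥ 2 + 16 log 128 (162 ≤ 128⁴).  Elementary. [cite: Balaban1988RG2Cluster, (1.32) p.9 and (2.19) p.16] -/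
theorem binders_kappa1_of_R7 {κ₁ : ℝ} (h : 2 + 16 * Real.log 128 ≤ κ₁) : 1 + 4 * Real.log 162 ≤ κ₁ := by
  have h162 : Real.log 162 ≤ 4 * Real.log 128 := by
    rw [← Real.log_rpow (by norm_num) 4]
    exact Real.log_le_log (by norm_num) (by norm_num)
  linarith

/-- … and in particular κ₁ ≥ 1. Elementary. [cite: Balaban1988RG2Cluster, (1.32) p.9] -/
theorem one_le_kappa1_of_R7 {κ₁ : ℝ} (h : 2 + 16 * Real.log 128 ≤ κ₁) : 1 ≤ κ₁ := by
  have := binders_kappa1_of_R7 h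
  linarith [Real.log_nonneg (show (1 : ℝ) ≤ 162 by norm_num)]

/-- The (2.20) threshold δκ ≥ 64 log 162 of `B13Lemma3TorusBinders` IS Lemma 1's (1.26) threshold δκ ≥ κ₀(64, 8)
(`B12TreeDecay.kappa₀`: κ₀(64, 8) = 64·log(2·9²)).  Elementary. [cite: Balaban1988RG2Cluster, (1.26) p.8 and (2.20) p.16] -/
theorem binders_deltaKappa_of_126 {x : ℝ} (h : kappa₀ 64 8 ≤ x) : 64 * Real.log 162 ≤ x := by
  have hk : kappa₀ 64 8 = 64 * Real.log 162 := by
    simp only [kappa₀, B12TreeDecay.a₀]; norm_num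
  rwa [hk] at h

/-- C₃ ≥ 0 from the floor `27·m·K·e^{κ₁−1} ≤ C₃M⁴e^{C₂κ₁}` of the p. 11 □-sum (K ≥ 0, M > 0).  Elementary.
[cite: Balaban1988RG2Cluster, (1.43) p.11] -/
theorem C3_nonneg_of_floor (c : B13.Consts) {K : ℝ} {m : ℕ} (hK : 0 ≤ K) (hM : 0 < c.M)
    (hfloor : 27 * m * K * Real.exp (c.κ₁ - 1) ≤ c.C₃ * c.M ^ 4 * Real.exp (c.C₂ * c.κ₁)) : 0 ≤ c.C₃ := by
  have hl : 0 ≤ 27 * (m : ℝ) * K * Real.exp (c.κ₁ - 1) := by positivity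
  have hx : 0 < c.M ^ 4 * Real.exp (c.C₂ * c.κ₁) := by positivity
  have h' : 0 ≤ c.C₃ * (c.M ^ 4 * Real.exp (c.C₂ * c.κ₁)) := by rw [← mul_assoc]; exact hl.trans hfloor
  exact nonneg_of_mul_nonneg_left h' hx

/-- `|τ(Y)|⁻¹ ≤ ½` for every localization domain from the number `E₀ε₁C₁α₄⁻¹M^q e^{C₂κ₁} ≤ ½` ((2.18):
`1/|τ(Y)| = E₀ε₁C₁α₄⁻¹M^q exp C₂κ₁ exp(−(1 − 3δ)κd_k(Y))`, the last factor ≤ 1 as (1 − 3δ)κ ≥ 0, d_k ≥ 0) — the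
τ-contours of (2.1)/(2.14) then enclose the unit interval.  Elementary. [cite: Balaban1988RG2Cluster, (2.18) p.16] -/
theorem invTau_le_half (c : B13.Consts) (hδ3 : 0 ≤ 1 - 3 * c.δ) (hκ : 0 ≤ c.κ)
    (hpre : 0 ≤ c.E₀ * c.ε₁ * c.C₁ * c.α₄⁻¹ * c.M ^ c.q * Real.exp (c.C₂ * c.κ₁))
    (hτ2 : c.E₀ * c.ε₁ * c.C₁ * c.α₄⁻¹ * c.M ^ c.q * Real.exp (c.C₂ * c.κ₁) ≤ 1 / 2) {d : ℝ} (hd : 0 ≤ d) :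
    invTau c d ≤ 1 / 2 := by
  have hexp : Real.exp (-(1 - 3 * c.δ) * c.κ * d) ≤ 1 := by
    rw [Real.exp_le_one_iff]
    have : 0 ≤ (1 - 3 * c.δ) * c.κ * d := mul_nonneg (mul_nonneg hδ3 hκ) hd
    linarith
  calc invTau c d = c.E₀ * c.ε₁ * c.C₁ * c.α₄⁻¹ * c.M ^ c.q * Real.exp (c.C₂ * c.κ₁) *
        Real.exp (-(1 - 3 * c.δ) * c.κ * d) := rfl
    _ ≤ c.E₀ * c.ε₁ * c.C₁ * c.α₄⁻¹ * c.M ^ c.q * Real.exp (c.C₂ * c.κ₁) * 1 := mul_le_mul_of_nonneg_left hexp hpre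
    _ ≤ 1 / 2 := by rw [mul_one]; exact hτ2

/-- The (1.36)-bound at the reduced constant `(1 − θ)E₀ε₁C₁M^q e^{C₂κ₁}` implies it at the full constant once the
headroom product is non-negative and `θ < 1` (p. 9: *"There exist absolute constants C₁, C₂, q"*).  Elementary.
[cite: Balaban1988RG2Cluster, (1.36) p.9] -/
theorem bound136_of_headroom (S : B13.StepData) (c : B13.Consts) (F : S.Dk.Dom → S.Φ → ℂ) {θ x : ℝ}
    (hθ0 : 0 ≤ θ) (hθ1 : θ < 1) (hx : 0 ≤ x)
    (hxC : x ≤ (1 - θ) * (c.E₀ * c.ε₁ * c.C₁ * c.M ^ c.q * Real.exp (c.C₂ * c.κ₁)))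
    (hF : ∀ Y φ, φ ∈ S.sp1 Y → ‖F Y φ‖ ≤ (1 - θ) * (c.E₀ * c.ε₁ * c.C₁ * c.M ^ c.q * Real.exp (c.C₂ * c.κ₁)) *
      Real.exp (-((1 - 2 * c.δ) * c.κ * S.Dk.dj Y))) :
    B13.Bound136 S c F := by
  intro Y φ hφ
  have h1θ : 0 < 1 - θ := sub_pos.2 hθ1
  have hX : 0 ≤ c.E₀ * c.ε₁ * c.C₁ * c.M ^ c.q * Real.exp (c.C₂ * c.κ₁) :=
    nonneg_of_mul_nonneg_right (hx.trans hxC) h1θ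
  have hle : (1 - θ) * (c.E₀ * c.ε₁ * c.C₁ * c.M ^ c.q * Real.exp (c.C₂ * c.κ₁)) ≤
      c.E₀ * c.ε₁ * c.C₁ * c.M ^ c.q * Real.exp (c.C₂ * c.κ₁) :=
    calc (1 - θ) * (c.E₀ * c.ε₁ * c.C₁ * c.M ^ c.q * Real.exp (c.C₂ * c.κ₁))
        = c.E₀ * c.ε₁ * c.C₁ * c.M ^ c.q * Real.exp (c.C₂ * c.κ₁) -
            θ * (c.E₀ * c.ε₁ * c.C₁ * c.M ^ c.q * Real.exp (c.C₂ * c.κ₁)) := by ring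
      _ ≤ c.E₀ * c.ε₁ * c.C₁ * c.M ^ c.q * Real.exp (c.C₂ * c.κ₁) := sub_le_self _ (mul_nonneg hθ0 hX)
  exact (hF Y φ hφ).trans (mul_le_mul_of_nonneg_right hle (Real.exp_nonneg _))

/-! ## §2. Lemma 1 ∧ Lemma 2 on the two-scale torus from located inputs, V″ general -/

section Torus

variable {L N' : ℕ} [NeZero L] [NeZero N']

open Classical in
/-- **LEMMA 1 ∧ LEMMA 2 ON THE TWO-SCALE TORUS FROM LOCATED INPUTS ONLY, V″_k = V′_k + LOCAL PIECES.**  For a two-scale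
torus step datum `Wt : TwoTorusStep 4 L N′` (𝐃_k = `tsys 4 (L·N′)`; L·N′ ≥ 12, L ≥ 2) and constants `c`:
(1) LEMMA 1 (pp. 7–9) — the decomposition (1.33) `h133` with its structural index data ([I]'s □₀ ⊂ Y by anchor cubes
`S0`, Y₀-families `F`, □′-families `Sq`/`Sq′`, domain families `SX`/`SX′` above □′, X₀ ⊆ Y, the (I.3.7)-chain cubes `Sc`
with the distance reading `dist`), per-term analyticity on (1.34) and closure of the reader-owned `Analytic`, per-term
(1.24)/(1.30) VERBATIM (`h124`, `h130`: by reference to (I.3.54), (I.3.17), [15] Prop. 4, [13] (3.108)), thresholds, R8,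
R9, the choice `hC` of C₁, C₂, q with headroom `(1 − θ)`, `0 ≤ θ < 1` (print: *"There exist absolute constants C₁,
C₂, q"*); (2) LEMMA 2 (pp. 10–11) — `V″_k(Y) = V′_k(Y) + G(Y)` (`hVpp`; G = the strictly local terms of P^{(k)} with
localization domain Y, cell census G-adv9-20 (c); G ≡ 0, θ = 0 is the reading V″_k := V′_k of `B13.lemma2_of_lemma1`)
with G analytic on (1.34) (`hGlAn`) and of (1.36)-shape at prefactor θ (`hGl`; for pieces supported on single cubes a
sup bound, d_k = 0); a complex normed space `E` of fluctuation fields on Y with the coordinate reading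
`rd Y φ = Σ_b B(b)e_{Y,b}` (`‖e_{Y,b}‖ ≤ 1`), per localization domain a finite family `s Y` of scaled cubic
`1/g_k²`-terms `Wf Y i φ` analytic on `‖z‖ < R` with `‖Wf Y i φ z‖ ≤ K₂e^{−(κ₁−1)(#Y−1)}‖z‖³` (the (1.38)/(1.39) data
per term, [15] by reference; `B13Lemma2TorusT7.cubicData_T7_of_polydisc` for the most important term), `#(s Y) ≤ m₂·#Y`,
`3ε₁ ≤ R`, the identifications `hV` (V_k = Σ scaled terms + V″_k) and `hQ` of the record on (1.34), (1.34) in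
coordinates `hsp`, `volk Y = #Y`, the floor `27·m₂·K₂·e^{κ₁−1} ≤ C₃M⁴e^{C₂κ₁}`, per-term analyticity `hAnP`, gauge
invariance `hG` (by assertion, cell GAPS G-B13-06).  CONCLUSION: `Lemma1Printed ∧ Lemma2Printed` for `Wt.toStepData`.
Inside: `lemma1Printed_twoTorus_blocks` at the constants `{c with E₀ := (1 − θ)E₀}` gives analyticity of V′_k and
(1.36) at the reduced constant, hence (1.36) at `c` (`bound136_of_headroom`) and, with `hGl`, (1.36) for V″_k
(`bound136_of_split`); then `lemma2Printed_twoTorus'`. [cite: Balaban1988RG2Cluster, Lemma 1 p.9, Lemma 2 p.11] -/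
theorem lemma12_twoTorus
    (Wt : TwoTorusStep 4 L N') (c : B13.Consts) (k : ℕ) (hN12 : 12 ≤ L * N') (hL2 : 2 ≤ L)
    -- (1) LEMMA 1: index data of (1.33)
    (S0 : TDom 4 (L * N') → Finset (TPt 4 (L * N')))
    (F : TDom 4 (L * N') → TPt 4 (L * N') → Finset (TPt 4 (L * N')))
    (Sq : TDom 4 (L * N') → TPt 4 (L * N') → (j : ℕ) → Finset (TPt 4 (L ^ (k - j) * (L * N'))))
    (SX : TDom 4 (L * N') → TPt 4 (L * N') → (j : ℕ) → TPt 4 (L ^ (k - j) * (L * N')) →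
      Finset (TDom 4 (L ^ (k - j) * (L * N'))))
    (T : TDom 4 (L * N') → TPt 4 (L * N') → Finset (TPt 4 (L * N')) → (j : ℕ) →
      TPt 4 (L ^ (k - j) * (L * N')) → TDom 4 (L ^ (k - j) * (L * N')) → Wt.Φ → ℂ)
    (Sc : TDom 4 (L * N') → Finset (TPt 4 (L * N')))
    (Sq' : TDom 4 (L * N') → TPt 4 (L * N') → (j : ℕ) → Finset (TPt 4 (L ^ (k - j) * (L * N'))))
    (SX' : TDom 4 (L * N') → TPt 4 (L * N') → (j : ℕ) → TPt 4 (L ^ (k - j) * (L * N')) →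
      Finset (TDom 4 (L ^ (k - j) * (L * N'))))
    (T' : TDom 4 (L * N') → TPt 4 (L * N') → (j : ℕ) → TPt 4 (L ^ (k - j) * (L * N')) →
      TDom 4 (L ^ (k - j) * (L * N')) → Wt.Φ → ℂ)
    (dist : TDom 4 (L * N') → TPt 4 (L * N') → (j : ℕ) → TPt 4 (L ^ (k - j) * (L * N')) → ℝ) {K K' : ℝ}
    (h133 : ∀ Y, Wt.Vp Y =
      (∑ a ∈ S0 Y, ∑ X ∈ (F Y a).powerset, ∑ j ∈ Finset.range (k + 1), ∑ q ∈ Sq Y a j,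
        ∑ x ∈ SX Y a j q, T Y a X j q x) +
      (∑ a ∈ Sc Y, ∑ j ∈ Finset.range (k + 1), ∑ q ∈ Sq' Y a j, ∑ x ∈ SX' Y a j q, T' Y a j q x))
    (hS0Y : ∀ Y, ∀ a ∈ S0 Y,
      (pbox (fun i => natLift a i - (5 : ℕ)) (fun i => natLift a i + 1 + (5 : ℕ))).image (proj (L * N')) ⊆ Y.1)
    (hFsub : ∀ Y a, F Y a ⊆
      (pbox (fun i => natLift a i - (5 : ℕ)) (fun i => natLift a i + 1 + (5 : ℕ))).image (proj (L * N')) \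
        (pbox (fun i => natLift a i - (4 : ℕ)) (fun i => natLift a i + 1 + (4 : ℕ))).image (proj (L * N')))
    (hSq : ∀ Y, ∀ a ∈ S0 Y, ∀ j, Sq Y a j ⊆ (Finset.univ : Finset (TPt 4 (L ^ (k - j) * (L * N')))).filter
      (fun q => tcoarse (L ^ (k - j)) (L * N') q ∈
        (pbox (fun i => natLift a i - (2 : ℕ)) (fun i => natLift a i + 1 + (2 : ℕ))).image (proj (L * N'))))
    (hScY : ∀ Y, Sc Y ⊆ Y.1)
    (hdist0 : ∀ Y a j q, 0 ≤ c.δ₀ * dist Y a j q)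
    (hdist : ∀ Y a j (n : ℕ) q, q ∉ (pbox (fun i => ((L ^ (k - j) : ℕ) : ℤ) * natLift a i - (n + 1 : ℕ))
      (fun i => ((L ^ (k - j) : ℕ) : ℤ) * natLift a i + 2 * ((L ^ (k - j) : ℕ) : ℤ) - 1 + (n + 1 : ℕ))).image
        (proj (L ^ (k - j) * (L * N'))) → c.δ₀ * c.M * ((n : ℝ) + 1) ≤ c.δ₀ * dist Y a j q)
    (hSX : ∀ Y a j q, SX Y a j q ⊆ (tcubeSys 4 (L ^ (k - j) * (L * N'))).above q)
    (hSX' : ∀ Y a j q, SX' Y a j q ⊆ (tcubeSys 4 (L ^ (k - j) * (L * N'))).above q)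
    (hX0 : ∀ Y, ∀ a ∈ Sc Y, ∀ j ∈ Finset.range (k + 1), ∀ q ∈ Sq' Y a j, ∀ x ∈ SX' Y a j q,
      x.1.image (tcoarse (L ^ (k - j)) (L * N')) ⊆ Y.1)
    -- (1) LEMMA 1: analyticity of the terms, closure of `Analytic`
    (hAdd : ∀ (s : Set Wt.Φ) (f g : Wt.Φ → ℂ), Wt.Analytic f s → Wt.Analytic g s → Wt.Analytic (f + g) s)
    (hZero : ∀ s : Set Wt.Φ, Wt.Analytic 0 s)
    (hAnT : ∀ Y, ∀ a ∈ S0 Y, ∀ X ∈ (F Y a).powerset, ∀ j ∈ Finset.range (k + 1), ∀ q ∈ Sq Y a j,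
      ∀ x ∈ SX Y a j q, Wt.Analytic (T Y a X j q x) (Wt.sp1 Y))
    (hAnT' : ∀ Y, ∀ a ∈ Sc Y, ∀ j ∈ Finset.range (k + 1), ∀ q ∈ Sq' Y a j, ∀ x ∈ SX' Y a j q,
      Wt.Analytic (T' Y a j q x) (Wt.sp1 Y))
    -- (1) LEMMA 1: thresholds and restrictions
    (hK : 0 ≤ K) (hK' : 0 ≤ K') (hκ : 0 ≤ c.κ) (hδ1 : c.δ < 1) (hδκ : 1 ≤ c.δ * c.κ)
    (hκ126 : kappa₀ 64 8 ≤ c.κ) (hκ126' : kappa₀ 64 8 ≤ c.δ * c.κ)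
    (hκ₁ : 1 + 2 * Real.log (8 * 12 ^ 3) ≤ c.κ₁) (hκ₁' : 2 + 16 * Real.log 128 ≤ c.κ₁)
    (hδ₀M : 10 * Real.exp (-1) ≤ c.δ₀ * c.M) (hδ₀M5 : 2 * Real.log 5 ≤ c.δ₀ * c.M)
    (hR8 : (1 - c.δ) * c.κ ≤ (1 / 4) * (c.κ₁ - 1)) (hR9 : (1 - 2 * c.δ) * c.κ ≤ (1 / 16) * c.κ₁)
    -- (1) LEMMA 1: per-term (1.24), (1.30); the constants of (1.36) with headroom (1 − θ) for the local pieces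
    (h124 : ∀ Y φ, φ ∈ Wt.sp1 Y → ∀ a ∈ S0 Y, ∀ X ∈ (F Y a).powerset, ∀ j ∈ Finset.range (k + 1), ∀ q ∈ Sq Y a j,
      ∀ x ∈ SX Y a j q,
        ‖T Y a X j q x φ‖ ≤ K * ((L : ℝ) ^ j * ((L : ℝ) ^ k)⁻¹) ^ 5 *
          Real.exp (-(c.κ₁ - 1) *
            (((Y.1 \ (pbox (fun i => natLift a i - (5 : ℕ)) (fun i => natLift a i + 1 + (5 : ℕ))).image
              (proj (L * N'))).card : ℝ) + X.card)) *
          Real.exp (-(c.κ * torusTreeLen x.1)))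
    (h130 : ∀ Y φ, φ ∈ Wt.sp1 Y → ∀ a ∈ Sc Y, ∀ j ∈ Finset.range (k + 1), ∀ q ∈ Sq' Y a j,
      ∀ x ∈ SX' Y a j q,
        ‖T' Y a j q x φ‖ ≤ K' * Real.exp (-(1 / 2) * (c.δ₀ * c.M) * ((L : ℝ) ^ j * ((L : ℝ) ^ k)⁻¹)⁻¹
            - (1 / 2) * c.δ₀ * dist Y a j q) *
          Real.exp (-(c.κ₁ - 1) * ((Y.1 \ x.1.image (tcoarse (L ^ (k - j)) (L * N'))).card : ℝ)) *
          Real.exp (-(c.κ * torusTreeLen x.1)))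
    {θ : ℝ} (hθ0 : 0 ≤ θ) (hθ1 : θ < 1)
    (hC : K * K₀ 64 8 * (2 * (6 * (L : ℝ)) ^ 4) * Real.exp 1 * Real.exp ((1 / 8) * c.κ₁ * (12 ^ 4 - 1)) +
        2 * (64 * K') * K₀ 64 8 * 1344 ≤
      (1 - θ) * (c.E₀ * c.ε₁ * c.C₁ * c.M ^ c.q * Real.exp (c.C₂ * c.κ₁)))
    -- (2) LEMMA 2 (pp. 10–11): V″_k = V′_k + the local pieces G of P^{(k)}, analytic and (1.36)-small at prefactor θ
    (Gl : TDom 4 (L * N') → Wt.Φ → ℂ) (hVpp : ∀ Y, Wt.Vpp Y = fun φ => Wt.Vp Y φ + Gl Y φ)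
    (hGlAn : ∀ Y, Wt.Analytic (Gl Y) (Wt.sp1 Y))
    (hGl : ∀ Y φ, φ ∈ Wt.sp1 Y → ‖Gl Y φ‖ ≤ θ * (c.E₀ * c.ε₁ * c.C₁ * c.M ^ c.q * Real.exp (c.C₂ * c.κ₁)) *
      Real.exp (-((1 - 2 * c.δ) * c.κ * (tsys 4 (L * N')).dj Y)))
    -- (2) LEMMA 2: the located per-term data of `B13Lemma2Torus.lemma2Printed_twoTorus'`
    {E : Type*} [NormedAddCommGroup E] [NormedSpace ℂ E]
    (rd : TDom 4 (L * N') → Wt.Φ → E) (e : TDom 4 (L * N') → Wt.Bond → E) (he : ∀ Y b, ‖e Y b‖ ≤ 1)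
    (hrd : ∀ Y φ, rd Y φ = haveI := Wt.finBond; ∑ b, Wt.Bv φ b • e Y b)
    {ι₂ : Type*} (s : TDom 4 (L * N') → Finset ι₂) (Wf : TDom 4 (L * N') → ι₂ → Wt.Φ → E → ℂ) {g : ℂ} (hg : g ≠ 0)
    {R K₂ : ℝ} {m₂ : ℕ} (hK₂ : 0 ≤ K₂) (hR : 0 < R) (h3 : 3 * c.ε₁ ≤ R)
    (hW : ∀ Y, ∀ i ∈ s Y, ∀ φ ∈ Wt.sp1 Y, AnalyticOnNhd ℂ (Wf Y i φ) (ball 0 R))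
    (hKW : ∀ Y, ∀ i ∈ s Y, ∀ φ ∈ Wt.sp1 Y, ∀ z ∈ ball (0 : E) R,
      ‖Wf Y i φ z‖ ≤ K₂ * Real.exp (-(c.κ₁ - 1) * ((Y.1.card : ℝ) - 1)) * ‖z‖ ^ 3)
    (hcard : ∀ Y, (s Y).card ≤ m₂ * Y.1.card)
    (hV : ∀ Y, Wt.V Y = fun φ => (∑ i ∈ s Y, scaled g (Wf Y i φ) (rd Y φ)) + Wt.Vpp Y φ)
    (hQ : ∀ Y φ (b b' : Wt.Bond), φ ∈ Wt.sp1 Y →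
      Wt.Q Y φ b b' = 2 * ∑ i ∈ s Y, Qop (scaled g (Wf Y i φ)) (rd Y φ) (e Y b) (e Y b'))
    (hsp : ∀ Y φ, φ ∈ Wt.sp1 Y → ‖g‖ * ‖rd Y φ‖ < c.ε₁)
    (hvolk : ∀ Y, Wt.volk Y = Y.1.card)
    (hfloor : 27 * m₂ * K₂ * Real.exp (c.κ₁ - 1) ≤ c.C₃ * c.M ^ 4 * Real.exp (c.C₂ * c.κ₁))
    (hAnP : ∀ Y, ∀ i ∈ s Y, Wt.Analytic (fun φ => scaled g (Wf Y i φ) (rd Y φ)) (Wt.sp1 Y))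
    (hG : ∀ Y, Wt.GaugeInv (Wt.V Y) ∧ Wt.GaugeInv (Wt.toStepData.quadForm Y) ∧ Wt.GaugeInv (Wt.Vpp Y))
    : B13.Lemma1Printed Wt.toStepData c ∧ B13.Lemma2Printed Wt.toStepData c := by
  -- Lemma 1 with [I]'s block geometry concrete, at the reduced constant (1 − θ)E₀
  have hCθ : K * K₀ 64 8 * (2 * (6 * (L : ℝ)) ^ 4) * Real.exp 1 * Real.exp ((1 / 8) * c.κ₁ * (12 ^ 4 - 1)) +
        2 * (64 * K') * K₀ 64 8 * 1344 ≤
      (1 - θ) * c.E₀ * c.ε₁ * c.C₁ * c.M ^ c.q * Real.exp (c.C₂ * c.κ₁) :=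
    hC.trans (le_of_eq (by ring))
  have h1θ : B13.Lemma1Printed Wt.toStepData { c with E₀ := (1 - θ) * c.E₀ } :=
    lemma1Printed_twoTorus_blocks Wt { c with E₀ := (1 - θ) * c.E₀ } k hN12 S0 F Sq SX T Sc Sq' SX' T' dist h133
      hS0Y hFsub hSq hScY hdist0 hdist hSX hSX' hX0 hAdd hZero hAnT hAnT' hK hK' hL2 hκ hδ1 hδκ hκ126 hκ126' hκ₁
      hκ₁' hδ₀M hδ₀M5 hR8 hR9 h124 h130 hCθ
  have hF : ∀ Y φ, φ ∈ Wt.sp1 Y → ‖Wt.Vp Y φ‖ ≤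
      (1 - θ) * (c.E₀ * c.ε₁ * c.C₁ * c.M ^ c.q * Real.exp (c.C₂ * c.κ₁)) *
        Real.exp (-((1 - 2 * c.δ) * c.κ * (tsys 4 (L * N')).dj Y)) := by
    intro Y φ hφ
    have h : ‖Wt.Vp Y φ‖ ≤ (1 - θ) * c.E₀ * c.ε₁ * c.C₁ * c.M ^ c.q * Real.exp (c.C₂ * c.κ₁) *
        Real.exp (-((1 - 2 * c.δ) * c.κ * (tsys 4 (L * N')).dj Y)) := h1θ.2 Y φ hφ
    exact h.trans (le_of_eq (by ring))
  have hx : 0 ≤ K * K₀ 64 8 * (2 * (6 * (L : ℝ)) ^ 4) * Real.exp 1 * Real.exp ((1 / 8) * c.κ₁ * (12 ^ 4 - 1)) +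
      2 * (64 * K') * K₀ 64 8 * 1344 := by
    have := B12TreeDecay.K₀_pos 64 8
    positivity
  -- Lemma 1 at the constants c
  have h1 : B13.Lemma1Printed Wt.toStepData c :=
    ⟨h1θ.1, bound136_of_headroom Wt.toStepData c Wt.Vp hθ0 hθ1 hx hC hF⟩
  -- (1.36) for V″ = V′ + G and its analyticity
  have h136pp : B13.Bound136 Wt.toStepData c Wt.Vpp := by
    intro Y φ hφ
    rw [hVpp Y]
    exact bound136_of_split Wt.toStepData c Wt.Vp Gl hF hGl Y φ hφ
  have hVppAn : ∀ Y, Wt.Analytic (Wt.Vpp Y) (Wt.sp1 Y) := fun Y => by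
    rw [hVpp Y]
    exact hAdd _ _ _ (h1.1 Y) (hGlAn Y)
  -- Lemma 2 from the located per-term data of pp. 10–11
  exact ⟨h1, lemma2Printed_twoTorus' Wt c hVppAn h136pp rd e he hrd s Wf hg hK₂ hR h3 hW hKW hcard hV hQ hsp hvolk
    (eleven_thirds_le_of_R7 hκ₁) hfloor hAdd hZero hAnP hG⟩

/-! ## §3. The leaf triple and the node at LEVEL T: (2.26) per term, termwise domination, numbers -/

open Classical in
/-- **THE B13 LEAF TRIPLE ON THE TWO-SCALE TORUS FROM LOCATED INPUTS ONLY** (c.L = L ≥ 8).  The inputs of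
`lemma12_twoTorus` (Lemmas 1–2) and, for LEMMA 3 (pp. 14–20) at LEVEL T of `B13Lemma3TorusSocket`: a term map `T₃`
over the torus term set (𝐃, P) of H(Z), termwise domination `hH` ((2.9)/(2.14)), (2.26) per term `h226`, and the
bundle `hN` of the printed restrictions on the constants at ℓ = ½L.  CONCLUSION: `Lemma1Printed ∧ Lemma2Printed ∧
Lemma3Printed` for `Wt.toStepData`; (2.38) = `bound238With_of_hRep ∘ hRep_of_termwise` at ℓ = ½L with (2.36) =
`ineq236Printed_torus` and `B13.bound238With_half`. [cite: Balaban1988RG2Cluster, Lemmas 1–3 pp.9, 11, 20] -/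
theorem b13Leaf_twoTorus_termwise
    (Wt : TwoTorusStep 4 L N') (c : B13.Consts) (k : ℕ) (hN12 : 12 ≤ L * N') (hL8 : 8 ≤ c.L) (hLc : c.L = L)
    -- (1) LEMMA 1: index data of (1.33)
    (S0 : TDom 4 (L * N') → Finset (TPt 4 (L * N')))
    (F : TDom 4 (L * N') → TPt 4 (L * N') → Finset (TPt 4 (L * N')))
    (Sq : TDom 4 (L * N') → TPt 4 (L * N') → (j : ℕ) → Finset (TPt 4 (L ^ (k - j) * (L * N'))))
    (SX : TDom 4 (L * N') → TPt 4 (L * N') → (j : ℕ) → TPt 4 (L ^ (k - j) * (L * N')) →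
      Finset (TDom 4 (L ^ (k - j) * (L * N'))))
    (T : TDom 4 (L * N') → TPt 4 (L * N') → Finset (TPt 4 (L * N')) → (j : ℕ) →
      TPt 4 (L ^ (k - j) * (L * N')) → TDom 4 (L ^ (k - j) * (L * N')) → Wt.Φ → ℂ)
    (Sc : TDom 4 (L * N') → Finset (TPt 4 (L * N')))
    (Sq' : TDom 4 (L * N') → TPt 4 (L * N') → (j : ℕ) → Finset (TPt 4 (L ^ (k - j) * (L * N'))))
    (SX' : TDom 4 (L * N') → TPt 4 (L * N') → (j : ℕ) → TPt 4 (L ^ (k - j) * (L * N')) →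
      Finset (TDom 4 (L ^ (k - j) * (L * N'))))
    (T' : TDom 4 (L * N') → TPt 4 (L * N') → (j : ℕ) → TPt 4 (L ^ (k - j) * (L * N')) →
      TDom 4 (L ^ (k - j) * (L * N')) → Wt.Φ → ℂ)
    (dist : TDom 4 (L * N') → TPt 4 (L * N') → (j : ℕ) → TPt 4 (L ^ (k - j) * (L * N')) → ℝ) {K K' : ℝ}
    (h133 : ∀ Y, Wt.Vp Y =
      (∑ a ∈ S0 Y, ∑ X ∈ (F Y a).powerset, ∑ j ∈ Finset.range (k + 1), ∑ q ∈ Sq Y a j,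
        ∑ x ∈ SX Y a j q, T Y a X j q x) +
      (∑ a ∈ Sc Y, ∑ j ∈ Finset.range (k + 1), ∑ q ∈ Sq' Y a j, ∑ x ∈ SX' Y a j q, T' Y a j q x))
    (hS0Y : ∀ Y, ∀ a ∈ S0 Y,
      (pbox (fun i => natLift a i - (5 : ℕ)) (fun i => natLift a i + 1 + (5 : ℕ))).image (proj (L * N')) ⊆ Y.1)
    (hFsub : ∀ Y a, F Y a ⊆
      (pbox (fun i => natLift a i - (5 : ℕ)) (fun i => natLift a i + 1 + (5 : ℕ))).image (proj (L * N')) \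
        (pbox (fun i => natLift a i - (4 : ℕ)) (fun i => natLift a i + 1 + (4 : ℕ))).image (proj (L * N')))
    (hSq : ∀ Y, ∀ a ∈ S0 Y, ∀ j, Sq Y a j ⊆ (Finset.univ : Finset (TPt 4 (L ^ (k - j) * (L * N')))).filter
      (fun q => tcoarse (L ^ (k - j)) (L * N') q ∈
        (pbox (fun i => natLift a i - (2 : ℕ)) (fun i => natLift a i + 1 + (2 : ℕ))).image (proj (L * N'))))
    (hScY : ∀ Y, Sc Y ⊆ Y.1)
    (hdist0 : ∀ Y a j q, 0 ≤ c.δ₀ * dist Y a j q)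
    (hdist : ∀ Y a j (n : ℕ) q, q ∉ (pbox (fun i => ((L ^ (k - j) : ℕ) : ℤ) * natLift a i - (n + 1 : ℕ))
      (fun i => ((L ^ (k - j) : ℕ) : ℤ) * natLift a i + 2 * ((L ^ (k - j) : ℕ) : ℤ) - 1 + (n + 1 : ℕ))).image
        (proj (L ^ (k - j) * (L * N'))) → c.δ₀ * c.M * ((n : ℝ) + 1) ≤ c.δ₀ * dist Y a j q)
    (hSX : ∀ Y a j q, SX Y a j q ⊆ (tcubeSys 4 (L ^ (k - j) * (L * N'))).above q)
    (hSX' : ∀ Y a j q, SX' Y a j q ⊆ (tcubeSys 4 (L ^ (k - j) * (L * N'))).above q)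
    (hX0 : ∀ Y, ∀ a ∈ Sc Y, ∀ j ∈ Finset.range (k + 1), ∀ q ∈ Sq' Y a j, ∀ x ∈ SX' Y a j q,
      x.1.image (tcoarse (L ^ (k - j)) (L * N')) ⊆ Y.1)
    -- (1) LEMMA 1: analyticity of the terms, closure of `Analytic`
    (hAdd : ∀ (s : Set Wt.Φ) (f g : Wt.Φ → ℂ), Wt.Analytic f s → Wt.Analytic g s → Wt.Analytic (f + g) s)
    (hZero : ∀ s : Set Wt.Φ, Wt.Analytic 0 s)
    (hAnT : ∀ Y, ∀ a ∈ S0 Y, ∀ X ∈ (F Y a).powerset, ∀ j ∈ Finset.range (k + 1), ∀ q ∈ Sq Y a j,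
      ∀ x ∈ SX Y a j q, Wt.Analytic (T Y a X j q x) (Wt.sp1 Y))
    (hAnT' : ∀ Y, ∀ a ∈ Sc Y, ∀ j ∈ Finset.range (k + 1), ∀ q ∈ Sq' Y a j, ∀ x ∈ SX' Y a j q,
      Wt.Analytic (T' Y a j q x) (Wt.sp1 Y))
    -- (1) LEMMA 1: thresholds and restrictions
    (hK : 0 ≤ K) (hK' : 0 ≤ K') (hκ : 0 ≤ c.κ) (hδ1 : c.δ < 1) (hδκ : 1 ≤ c.δ * c.κ)
    (hκ126 : kappa₀ 64 8 ≤ c.κ) (hκ126' : kappa₀ 64 8 ≤ c.δ * c.κ)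
    (hκ₁ : 1 + 2 * Real.log (8 * 12 ^ 3) ≤ c.κ₁) (hκ₁' : 2 + 16 * Real.log 128 ≤ c.κ₁)
    (hδ₀M : 10 * Real.exp (-1) ≤ c.δ₀ * c.M) (hδ₀M5 : 2 * Real.log 5 ≤ c.δ₀ * c.M)
    (hR8 : (1 - c.δ) * c.κ ≤ (1 / 4) * (c.κ₁ - 1)) (hR9 : (1 - 2 * c.δ) * c.κ ≤ (1 / 16) * c.κ₁)
    -- (1) LEMMA 1: per-term (1.24), (1.30); the constants of (1.36) with headroom (1 − θ) for the local pieces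
    (h124 : ∀ Y φ, φ ∈ Wt.sp1 Y → ∀ a ∈ S0 Y, ∀ X ∈ (F Y a).powerset, ∀ j ∈ Finset.range (k + 1), ∀ q ∈ Sq Y a j,
      ∀ x ∈ SX Y a j q,
        ‖T Y a X j q x φ‖ ≤ K * ((L : ℝ) ^ j * ((L : ℝ) ^ k)⁻¹) ^ 5 *
          Real.exp (-(c.κ₁ - 1) *
            (((Y.1 \ (pbox (fun i => natLift a i - (5 : ℕ)) (fun i => natLift a i + 1 + (5 : ℕ))).image
              (proj (L * N'))).card : ℝ) + X.card)) *
          Real.exp (-(c.κ * torusTreeLen x.1)))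
    (h130 : ∀ Y φ, φ ∈ Wt.sp1 Y → ∀ a ∈ Sc Y, ∀ j ∈ Finset.range (k + 1), ∀ q ∈ Sq' Y a j,
      ∀ x ∈ SX' Y a j q,
        ‖T' Y a j q x φ‖ ≤ K' * Real.exp (-(1 / 2) * (c.δ₀ * c.M) * ((L : ℝ) ^ j * ((L : ℝ) ^ k)⁻¹)⁻¹
            - (1 / 2) * c.δ₀ * dist Y a j q) *
          Real.exp (-(c.κ₁ - 1) * ((Y.1 \ x.1.image (tcoarse (L ^ (k - j)) (L * N'))).card : ℝ)) *
          Real.exp (-(c.κ * torusTreeLen x.1)))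
    {θ : ℝ} (hθ0 : 0 ≤ θ) (hθ1 : θ < 1)
    (hC : K * K₀ 64 8 * (2 * (6 * (L : ℝ)) ^ 4) * Real.exp 1 * Real.exp ((1 / 8) * c.κ₁ * (12 ^ 4 - 1)) +
        2 * (64 * K') * K₀ 64 8 * 1344 ≤
      (1 - θ) * (c.E₀ * c.ε₁ * c.C₁ * c.M ^ c.q * Real.exp (c.C₂ * c.κ₁)))
    -- (2) LEMMA 2 (pp. 10–11): V″_k = V′_k + the local pieces G of P^{(k)}, analytic and (1.36)-small at prefactor θ
    (Gl : TDom 4 (L * N') → Wt.Φ → ℂ) (hVpp : ∀ Y, Wt.Vpp Y = fun φ => Wt.Vp Y φ + Gl Y φ)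
    (hGlAn : ∀ Y, Wt.Analytic (Gl Y) (Wt.sp1 Y))
    (hGl : ∀ Y φ, φ ∈ Wt.sp1 Y → ‖Gl Y φ‖ ≤ θ * (c.E₀ * c.ε₁ * c.C₁ * c.M ^ c.q * Real.exp (c.C₂ * c.κ₁)) *
      Real.exp (-((1 - 2 * c.δ) * c.κ * (tsys 4 (L * N')).dj Y)))
    -- (2) LEMMA 2: the located per-term data of `B13Lemma2Torus.lemma2Printed_twoTorus'`
    {E : Type*} [NormedAddCommGroup E] [NormedSpace ℂ E]
    (rd : TDom 4 (L * N') → Wt.Φ → E) (e : TDom 4 (L * N') → Wt.Bond → E) (he : ∀ Y b, ‖e Y b‖ ≤ 1)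
    (hrd : ∀ Y φ, rd Y φ = haveI := Wt.finBond; ∑ b, Wt.Bv φ b • e Y b)
    {ι₂ : Type*} (s : TDom 4 (L * N') → Finset ι₂) (Wf : TDom 4 (L * N') → ι₂ → Wt.Φ → E → ℂ) {g : ℂ} (hg : g ≠ 0)
    {R K₂ : ℝ} {m₂ : ℕ} (hK₂ : 0 ≤ K₂) (hR : 0 < R) (h3 : 3 * c.ε₁ ≤ R)
    (hW : ∀ Y, ∀ i ∈ s Y, ∀ φ ∈ Wt.sp1 Y, AnalyticOnNhd ℂ (Wf Y i φ) (ball 0 R))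
    (hKW : ∀ Y, ∀ i ∈ s Y, ∀ φ ∈ Wt.sp1 Y, ∀ z ∈ ball (0 : E) R,
      ‖Wf Y i φ z‖ ≤ K₂ * Real.exp (-(c.κ₁ - 1) * ((Y.1.card : ℝ) - 1)) * ‖z‖ ^ 3)
    (hcard : ∀ Y, (s Y).card ≤ m₂ * Y.1.card)
    (hV : ∀ Y, Wt.V Y = fun φ => (∑ i ∈ s Y, scaled g (Wf Y i φ) (rd Y φ)) + Wt.Vpp Y φ)
    (hQ : ∀ Y φ (b b' : Wt.Bond), φ ∈ Wt.sp1 Y →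
      Wt.Q Y φ b b' = 2 * ∑ i ∈ s Y, Qop (scaled g (Wf Y i φ)) (rd Y φ) (e Y b) (e Y b'))
    (hsp : ∀ Y φ, φ ∈ Wt.sp1 Y → ‖g‖ * ‖rd Y φ‖ < c.ε₁)
    (hvolk : ∀ Y, Wt.volk Y = Y.1.card)
    (hfloor : 27 * m₂ * K₂ * Real.exp (c.κ₁ - 1) ≤ c.C₃ * c.M ^ 4 * Real.exp (c.C₂ * c.κ₁))
    (hAnP : ∀ Y, ∀ i ∈ s Y, Wt.Analytic (fun φ => scaled g (Wf Y i φ) (rd Y φ)) (Wt.sp1 Y))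
    (hG : ∀ Y, Wt.GaugeInv (Wt.V Y) ∧ Wt.GaugeInv (Wt.toStepData.quadForm Y) ∧ Wt.GaugeInv (Wt.Vpp Y))
    -- (3) LEMMA 3 (pp. 14–20) at LEVEL T: the terms of H(Z), termwise domination, (2.26) per term, the numbers
    (M₃ : ℕ) [NeZero M₃]
    (T₃ : (Z : TDom 4 N') → Finset (TDom 4 (L * N')) × Finset (TBond 4 M₃ (L * N')) → Wt.Φ → ℂ)
    {a a₂ a₂' a₅ Aabs : ℝ} (hH : TermDomination M₃ Wt T₃) (h226 : Termwise226 c a a₅ Wt T₃)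
    (hN : Lemma3Numerics c M₃ ((c.L : ℝ) / 2) a a₂ a₂' a₅ Aabs) :
    B13.Lemma1Printed Wt.toStepData c ∧ B13.Lemma2Printed Wt.toStepData c ∧ B13.Lemma3Printed Wt.toStepData c := by
  have hL2 : 2 ≤ L := by rw [← hLc]; exact le_trans (by norm_num) hL8
  have h12 := lemma12_twoTorus Wt c k hN12 hL2 S0 F Sq SX T Sc Sq' SX' T' dist h133 hS0Y hFsub hSq hScY hdist0 hdist hSX hSX' hX0 hAdd hZero hAnT hAnT' hK hK' hκ hδ1 hδκ hκ126 hκ126' hκ₁ hκ₁' hδ₀M hδ₀M5 hR8 hR9 h124 h130 hθ0 hθ1 hC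
    Gl hVpp hGlAn hGl rd e he hrd s Wf hg hK₂ hR h3 hW hKW hcard hV hQ hsp hvolk hfloor hAnP hG
  -- Lemma 3: (2.38) at ℓ = ½L from (2.26) per term, termwise domination and the numbers
  have h236 : B13.Ineq236With (tsys 4 (L * N')) (tsys 4 N') (tclosureDom L N') ((c.L : ℝ) / 2) := by
    rw [hLc]
    exact ineq236Printed_torus (d := 4) L N' (hLc ▸ hL8)
  have h238 : B13.Bound238 Wt.toStepData c :=
    (B13.bound238With_half Wt.toStepData c).1
      (bound238With_of_hRep c hLc Wt M₃ hN h236 (hRep_of_termwise c (mul_nonneg hN.hα₆.le hN.hε₀) Wt T₃ hH h226))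
  exact ⟨h12.1, h12.2, fun _ => h238⟩

/-- **The node from the torus leaf** (bookkeeping, for pins that compose by name): at a binding of record whose B13
group is `(Wt.toStepData, c)`, the leaf triple for `Wt.toStepData` gives `Dag.B13_main (leavesP w P)`.
[cite: Balaban1988RG2Cluster, Lemmas 1–3 pp.9, 11, 20 (dictionary, bookkeeping)] -/
theorem b13_main_of_leaf_twoTorus (w : WorldP) (P : B12.RunParams) (X : PrintedCarriersR) (Y9 : PrintedCarriers9X)
    (Z11 : PrintedCarriers11) (V14 : PrintedCarriers14R) (W15 : PrintedCarriers15)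
    (hP : w.up P = Upstream.ofPrintedAllXPN X Y9 Z11 V14 W15) (Wt : TwoTorusStep 4 L N') (c : B13.Consts)
    (hS : X.S13 = Wt.toStepData) (hc : X.c13 = c)
    (h : B13.Lemma1Printed Wt.toStepData c ∧ B13.Lemma2Printed Wt.toStepData c ∧ B13.Lemma3Printed Wt.toStepData c) :
    Dag.B13_main (leavesP w P) := by
  refine b13_main_of_leaf w P X Y9 Z11 V14 W15 hP ?_
  rw [hS, hc]
  exact h

open Classical in
/-- **N10 ON THE TWO-SCALE TORUS WITH NO LEAF CONJUNCT ENTERING AS TYPED.**  For every binding of record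
`w.up P = Upstream.ofPrintedAllXPN X Y Z V W′` whose B13 group is the two-scale torus step datum and constants
`(Wt.toStepData, c)` (`hS`, `hc`), the located inputs of `b13Leaf_twoTorus_termwise` — Lemma 1's per-term data and
numbers, V″_k = V′_k + local pieces, Lemma 2's per-cube scaled cubic terms and identifications, Lemma 3's terms with
termwise domination, (2.26) per term and the restrictions on the constants — give `Dag.B13_main (leavesP w P)`, the
shape the D-0059 route stub `stub_N10_B13 : Dag.B13_main` closes against once NODE 00 pins the B13 group with these
data (today FREE: `Node00.CarriersFrame.carriers₁_groupB13`; nothing is discharged here).  The typed leaves b9, b10,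
b11, b12 are not consumed (`B13LeafTorus.b13_main_iff_leaf`): their content enters through `h124`/`h130`, the (1.38)
data and `h226`. [cite: Balaban1988RG2Cluster, Lemmas 1–3 pp.9, 11, 20] -/
theorem b13_main_twoTorus_termwise
    -- (0) the binding of record and the B13 group
    (w : WorldP) (P : B12.RunParams) (X : PrintedCarriersR) (Y9 : PrintedCarriers9X) (Z11 : PrintedCarriers11)
    (V14 : PrintedCarriers14R) (W15 : PrintedCarriers15) (hP : w.up P = Upstream.ofPrintedAllXPN X Y9 Z11 V14 W15)
    (Wt : TwoTorusStep 4 L N') (c : B13.Consts) (hS : X.S13 = Wt.toStepData) (hc : X.c13 = c)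
    (k : ℕ) (hN12 : 12 ≤ L * N') (hL8 : 8 ≤ c.L) (hLc : c.L = L)
    -- (1) LEMMA 1: index data of (1.33)
    (S0 : TDom 4 (L * N') → Finset (TPt 4 (L * N')))
    (F : TDom 4 (L * N') → TPt 4 (L * N') → Finset (TPt 4 (L * N')))
    (Sq : TDom 4 (L * N') → TPt 4 (L * N') → (j : ℕ) → Finset (TPt 4 (L ^ (k - j) * (L * N'))))
    (SX : TDom 4 (L * N') → TPt 4 (L * N') → (j : ℕ) → TPt 4 (L ^ (k - j) * (L * N')) →
      Finset (TDom 4 (L ^ (k - j) * (L * N'))))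
    (T : TDom 4 (L * N') → TPt 4 (L * N') → Finset (TPt 4 (L * N')) → (j : ℕ) →
      TPt 4 (L ^ (k - j) * (L * N')) → TDom 4 (L ^ (k - j) * (L * N')) → Wt.Φ → ℂ)
    (Sc : TDom 4 (L * N') → Finset (TPt 4 (L * N')))
    (Sq' : TDom 4 (L * N') → TPt 4 (L * N') → (j : ℕ) → Finset (TPt 4 (L ^ (k - j) * (L * N'))))
    (SX' : TDom 4 (L * N') → TPt 4 (L * N') → (j : ℕ) → TPt 4 (L ^ (k - j) * (L * N')) →
      Finset (TDom 4 (L ^ (k - j) * (L * N'))))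
    (T' : TDom 4 (L * N') → TPt 4 (L * N') → (j : ℕ) → TPt 4 (L ^ (k - j) * (L * N')) →
      TDom 4 (L ^ (k - j) * (L * N')) → Wt.Φ → ℂ)
    (dist : TDom 4 (L * N') → TPt 4 (L * N') → (j : ℕ) → TPt 4 (L ^ (k - j) * (L * N')) → ℝ) {K K' : ℝ}
    (h133 : ∀ Y, Wt.Vp Y =
      (∑ a ∈ S0 Y, ∑ X ∈ (F Y a).powerset, ∑ j ∈ Finset.range (k + 1), ∑ q ∈ Sq Y a j,
        ∑ x ∈ SX Y a j q, T Y a X j q x) +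
      (∑ a ∈ Sc Y, ∑ j ∈ Finset.range (k + 1), ∑ q ∈ Sq' Y a j, ∑ x ∈ SX' Y a j q, T' Y a j q x))
    (hS0Y : ∀ Y, ∀ a ∈ S0 Y,
      (pbox (fun i => natLift a i - (5 : ℕ)) (fun i => natLift a i + 1 + (5 : ℕ))).image (proj (L * N')) ⊆ Y.1)
    (hFsub : ∀ Y a, F Y a ⊆
      (pbox (fun i => natLift a i - (5 : ℕ)) (fun i => natLift a i + 1 + (5 : ℕ))).image (proj (L * N')) \
        (pbox (fun i => natLift a i - (4 : ℕ)) (fun i => natLift a i + 1 + (4 : ℕ))).image (proj (L * N')))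
    (hSq : ∀ Y, ∀ a ∈ S0 Y, ∀ j, Sq Y a j ⊆ (Finset.univ : Finset (TPt 4 (L ^ (k - j) * (L * N')))).filter
      (fun q => tcoarse (L ^ (k - j)) (L * N') q ∈
        (pbox (fun i => natLift a i - (2 : ℕ)) (fun i => natLift a i + 1 + (2 : ℕ))).image (proj (L * N'))))
    (hScY : ∀ Y, Sc Y ⊆ Y.1)
    (hdist0 : ∀ Y a j q, 0 ≤ c.δ₀ * dist Y a j q)
    (hdist : ∀ Y a j (n : ℕ) q, q ∉ (pbox (fun i => ((L ^ (k - j) : ℕ) : ℤ) * natLift a i - (n + 1 : ℕ))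
      (fun i => ((L ^ (k - j) : ℕ) : ℤ) * natLift a i + 2 * ((L ^ (k - j) : ℕ) : ℤ) - 1 + (n + 1 : ℕ))).image
        (proj (L ^ (k - j) * (L * N'))) → c.δ₀ * c.M * ((n : ℝ) + 1) ≤ c.δ₀ * dist Y a j q)
    (hSX : ∀ Y a j q, SX Y a j q ⊆ (tcubeSys 4 (L ^ (k - j) * (L * N'))).above q)
    (hSX' : ∀ Y a j q, SX' Y a j q ⊆ (tcubeSys 4 (L ^ (k - j) * (L * N'))).above q)
    (hX0 : ∀ Y, ∀ a ∈ Sc Y, ∀ j ∈ Finset.range (k + 1), ∀ q ∈ Sq' Y a j, ∀ x ∈ SX' Y a j q,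
      x.1.image (tcoarse (L ^ (k - j)) (L * N')) ⊆ Y.1)
    -- (1) LEMMA 1: analyticity of the terms, closure of `Analytic`
    (hAdd : ∀ (s : Set Wt.Φ) (f g : Wt.Φ → ℂ), Wt.Analytic f s → Wt.Analytic g s → Wt.Analytic (f + g) s)
    (hZero : ∀ s : Set Wt.Φ, Wt.Analytic 0 s)
    (hAnT : ∀ Y, ∀ a ∈ S0 Y, ∀ X ∈ (F Y a).powerset, ∀ j ∈ Finset.range (k + 1), ∀ q ∈ Sq Y a j,
      ∀ x ∈ SX Y a j q, Wt.Analytic (T Y a X j q x) (Wt.sp1 Y))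
    (hAnT' : ∀ Y, ∀ a ∈ Sc Y, ∀ j ∈ Finset.range (k + 1), ∀ q ∈ Sq' Y a j, ∀ x ∈ SX' Y a j q,
      Wt.Analytic (T' Y a j q x) (Wt.sp1 Y))
    -- (1) LEMMA 1: thresholds and restrictions
    (hK : 0 ≤ K) (hK' : 0 ≤ K') (hκ : 0 ≤ c.κ) (hδ1 : c.δ < 1) (hδκ : 1 ≤ c.δ * c.κ)
    (hκ126 : kappa₀ 64 8 ≤ c.κ) (hκ126' : kappa₀ 64 8 ≤ c.δ * c.κ)
    (hκ₁ : 1 + 2 * Real.log (8 * 12 ^ 3) ≤ c.κ₁) (hκ₁' : 2 + 16 * Real.log 128 ≤ c.κ₁)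
    (hδ₀M : 10 * Real.exp (-1) ≤ c.δ₀ * c.M) (hδ₀M5 : 2 * Real.log 5 ≤ c.δ₀ * c.M)
    (hR8 : (1 - c.δ) * c.κ ≤ (1 / 4) * (c.κ₁ - 1)) (hR9 : (1 - 2 * c.δ) * c.κ ≤ (1 / 16) * c.κ₁)
    -- (1) LEMMA 1: per-term (1.24), (1.30); the constants of (1.36) with headroom (1 − θ) for the local pieces
    (h124 : ∀ Y φ, φ ∈ Wt.sp1 Y → ∀ a ∈ S0 Y, ∀ X ∈ (F Y a).powerset, ∀ j ∈ Finset.range (k + 1), ∀ q ∈ Sq Y a j,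
      ∀ x ∈ SX Y a j q,
        ‖T Y a X j q x φ‖ ≤ K * ((L : ℝ) ^ j * ((L : ℝ) ^ k)⁻¹) ^ 5 *
          Real.exp (-(c.κ₁ - 1) *
            (((Y.1 \ (pbox (fun i => natLift a i - (5 : ℕ)) (fun i => natLift a i + 1 + (5 : ℕ))).image
              (proj (L * N'))).card : ℝ) + X.card)) *
          Real.exp (-(c.κ * torusTreeLen x.1)))
    (h130 : ∀ Y φ, φ ∈ Wt.sp1 Y → ∀ a ∈ Sc Y, ∀ j ∈ Finset.range (k + 1), ∀ q ∈ Sq' Y a j,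
      ∀ x ∈ SX' Y a j q,
        ‖T' Y a j q x φ‖ ≤ K' * Real.exp (-(1 / 2) * (c.δ₀ * c.M) * ((L : ℝ) ^ j * ((L : ℝ) ^ k)⁻¹)⁻¹
            - (1 / 2) * c.δ₀ * dist Y a j q) *
          Real.exp (-(c.κ₁ - 1) * ((Y.1 \ x.1.image (tcoarse (L ^ (k - j)) (L * N'))).card : ℝ)) *
          Real.exp (-(c.κ * torusTreeLen x.1)))
    {θ : ℝ} (hθ0 : 0 ≤ θ) (hθ1 : θ < 1)
    (hC : K * K₀ 64 8 * (2 * (6 * (L : ℝ)) ^ 4) * Real.exp 1 * Real.exp ((1 / 8) * c.κ₁ * (12 ^ 4 - 1)) +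
        2 * (64 * K') * K₀ 64 8 * 1344 ≤
      (1 - θ) * (c.E₀ * c.ε₁ * c.C₁ * c.M ^ c.q * Real.exp (c.C₂ * c.κ₁)))
    -- (2) LEMMA 2 (pp. 10–11): V″_k = V′_k + the local pieces G of P^{(k)}, analytic and (1.36)-small at prefactor θ
    (Gl : TDom 4 (L * N') → Wt.Φ → ℂ) (hVpp : ∀ Y, Wt.Vpp Y = fun φ => Wt.Vp Y φ + Gl Y φ)
    (hGlAn : ∀ Y, Wt.Analytic (Gl Y) (Wt.sp1 Y))
    (hGl : ∀ Y φ, φ ∈ Wt.sp1 Y → ‖Gl Y φ‖ ≤ θ * (c.E₀ * c.ε₁ * c.C₁ * c.M ^ c.q * Real.exp (c.C₂ * c.κ₁)) *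
      Real.exp (-((1 - 2 * c.δ) * c.κ * (tsys 4 (L * N')).dj Y)))
    -- (2) LEMMA 2: the located per-term data of `B13Lemma2Torus.lemma2Printed_twoTorus'`
    {E : Type*} [NormedAddCommGroup E] [NormedSpace ℂ E]
    (rd : TDom 4 (L * N') → Wt.Φ → E) (e : TDom 4 (L * N') → Wt.Bond → E) (he : ∀ Y b, ‖e Y b‖ ≤ 1)
    (hrd : ∀ Y φ, rd Y φ = haveI := Wt.finBond; ∑ b, Wt.Bv φ b • e Y b)
    {ι₂ : Type*} (s : TDom 4 (L * N') → Finset ι₂) (Wf : TDom 4 (L * N') → ι₂ → Wt.Φ → E → ℂ) {g : ℂ} (hg : g ≠ 0)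
    {R K₂ : ℝ} {m₂ : ℕ} (hK₂ : 0 ≤ K₂) (hR : 0 < R) (h3 : 3 * c.ε₁ ≤ R)
    (hW : ∀ Y, ∀ i ∈ s Y, ∀ φ ∈ Wt.sp1 Y, AnalyticOnNhd ℂ (Wf Y i φ) (ball 0 R))
    (hKW : ∀ Y, ∀ i ∈ s Y, ∀ φ ∈ Wt.sp1 Y, ∀ z ∈ ball (0 : E) R,
      ‖Wf Y i φ z‖ ≤ K₂ * Real.exp (-(c.κ₁ - 1) * ((Y.1.card : ℝ) - 1)) * ‖z‖ ^ 3)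
    (hcard : ∀ Y, (s Y).card ≤ m₂ * Y.1.card)
    (hV : ∀ Y, Wt.V Y = fun φ => (∑ i ∈ s Y, scaled g (Wf Y i φ) (rd Y φ)) + Wt.Vpp Y φ)
    (hQ : ∀ Y φ (b b' : Wt.Bond), φ ∈ Wt.sp1 Y →
      Wt.Q Y φ b b' = 2 * ∑ i ∈ s Y, Qop (scaled g (Wf Y i φ)) (rd Y φ) (e Y b) (e Y b'))
    (hsp : ∀ Y φ, φ ∈ Wt.sp1 Y → ‖g‖ * ‖rd Y φ‖ < c.ε₁)
    (hvolk : ∀ Y, Wt.volk Y = Y.1.card)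
    (hfloor : 27 * m₂ * K₂ * Real.exp (c.κ₁ - 1) ≤ c.C₃ * c.M ^ 4 * Real.exp (c.C₂ * c.κ₁))
    (hAnP : ∀ Y, ∀ i ∈ s Y, Wt.Analytic (fun φ => scaled g (Wf Y i φ) (rd Y φ)) (Wt.sp1 Y))
    (hG : ∀ Y, Wt.GaugeInv (Wt.V Y) ∧ Wt.GaugeInv (Wt.toStepData.quadForm Y) ∧ Wt.GaugeInv (Wt.Vpp Y))
    -- (3) LEMMA 3 (pp. 14–20) at LEVEL T: the terms of H(Z), termwise domination, (2.26) per term, the numbers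
    (M₃ : ℕ) [NeZero M₃]
    (T₃ : (Z : TDom 4 N') → Finset (TDom 4 (L * N')) × Finset (TBond 4 M₃ (L * N')) → Wt.Φ → ℂ)
    {a a₂ a₂' a₅ Aabs : ℝ} (hH : TermDomination M₃ Wt T₃) (h226 : Termwise226 c a a₅ Wt T₃)
    (hN : Lemma3Numerics c M₃ ((c.L : ℝ) / 2) a a₂ a₂' a₅ Aabs) :
    Dag.B13_main (leavesP w P) :=
  b13_main_of_leaf_twoTorus w P X Y9 Z11 V14 W15 hP Wt c hS hc
    (b13Leaf_twoTorus_termwise Wt c k hN12 hL8 hLc S0 F Sq SX T Sc Sq' SX' T' dist h133 hS0Y hFsub hSq hScY hdist0 hdist hSX hSX' hX0 hAdd hZero hAnT hAnT' hK hK' hκ hδ1 hδκ hκ126 hκ126' hκ₁ hκ₁' hδ₀M hδ₀M5 hR8 hR9 h124 h130 hθ0 hθ1 hC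
      Gl hVpp hGlAn hGl rd e he hrd s Wf hg hK₂ hR h3 hW hKW hcard hV hQ hsp hvolk hfloor hAnP hG M₃ T₃ hH h226 hN)

end Torus

/-! ## §4. One level below LEVEL T: (2.26) per term from the primitive objects of NODE O

`B13Lemma3TorusBinders.h226_torus_of_primitives_of_lemma2` produces the letter `h226` for ONE term realized as the
display (2.14) `term214 r (Z∖Z′₀) 𝐃 (core214 A Γ (F214 |P| χ_{Y₀} χᶜ_P 𝐃 V)) 0 0` from the primitive kernels and
Lemma 2 of the record; with Lemma 2 PROVED from its located inputs (§2) the leaf triple follows from per-term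
PRIMITIVE data alone. -/

section Primitives

variable {L N' : ℕ} [NeZero L] [NeZero N']

open Matrix

open Classical in
/-- **THE B13 LEAF TRIPLE ON THE TWO-SCALE TORUS FROM LEMMA 1's AND LEMMA 2's LOCATED INPUTS AND LEMMA 3's PRIMITIVE
OBJECTS PER TERM.**  As `b13Leaf_twoTorus_termwise`, with the Lemma-3 letter `h226` ((2.26) per term) REPLACED by
the data of `B13Lemma3TorusBinders.h226_torus_of_primitives_of_lemma2` for every term `t = (𝐃, P) ∈ terms L M₃ Z` of
every `Z ∈ 𝐃_{k+1}` at every configuration of the space of p. 15 (`φ ∈ Wt.sp2 Z`): the term IS the display (2.14)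
(`hH`: termwise domination of H(Z) by these displays, (2.9)/(2.14)); per term the bond/Gaussian index types `Λ`, `C₀`,
the parameter lists `lZ` (Z∖Z′₀) and `lD` (𝐃), the σ-families of precisions `A(σ) = C^{(k)}(Z₀, σ)⁻¹` and linear maps
`Γ(σ)` with kernels `G(σ)` (`hAs`, `hA`, `hlin`), the (2.3) characteristic functions (`χ_{Y₀} ∈ [0, 1]`,
`χᶜ_P = Π_{b∈P} χ(r_P ≤ |B(b)|)`, `|P| = #P`), the sub-family `Dfam` and potentials `Vr` agreeing with the record's
V_k on (1.34) through the embedding `emb` of the real field (`hBv`, `hBv0`, `hVr`), the small-field support of `χ_{Y₀}`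
(`hχsupp`), separate holomorphy of the X-integral in (σ, τ) (`hΨσ`, `hΨτ`), the reference covariance `C ≻ 0` with its
eigenvalue bound and `Γ₀` (`hCq`, `hΓq`), the bonds located on a site torus `UT Nf` with ≤ m per site and ≤ m′ per
M-cube (`hfibΛ`, `hfibN`, `hfibc`), the UNIFORM LOCALISATION of the primitive kernels `G(σ)`, `Γ₀`, `A(σ)⁻¹`, `C`
(`hGb`, `hΓ₀b`, `hCs`, `hC216` — «L17a», [13]) and the (2.16)-type bounds of their σ-differences (`hdΓ`, `hdC`, `hdE` —
«L16a»), the rates and smallness numerics of (2.24)–(2.25) with `a₂₀ = m′α₄M⁻⁴(1 + 32/(κ₁−1))⁴`, the constant matchings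
`hPa : a ≤ γ₂r_P²` and `hvol` (p. 17, `w = K₀(64,8)α₄#(⋃𝐃)`); globally the Cauchy radius and parameter domains (`r`,
`Uσ ⊇ {|σ| ≤ e^{κ₁}}`, `Uτ ⊇ {|τ| ≤ |τ(Y)|}`), |τ(Y)| ≥ 2 as the number `hτ2`, R12, the signs of E₀, ε₁, C₁, α₄,
M ≥ 1, the cube map of the record's bonds with the support of Q (`hQsupp`), and the numerics bundle `hN` at ℓ = ½L.
The Lemma-2 binders `hrepr`/`h143`/`h136` of the capstone are DISCHARGED INSIDE by §2; κ₁ ≥ 1 + 4 log 162,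
δκ ≥ 64 log 162, κ₁ ≥ 11/3, C₃ ≥ 0, |τ(Y)|⁻¹ ∈ ]0, ½] are derived from Lemma 1's thresholds, the floor and `hτ2`.
CONCLUSION: `Lemma1Printed ∧ Lemma2Printed ∧ Lemma3Printed` for `Wt.toStepData`; the node follows by
`b13_main_of_leaf_twoTorus`.  What remains by assertion is object-level: the primitive kernels with L17a/L16a
([13] = [Balaban1985BackgroundPropagators] Thm 3.15 ff., k-uniform), termwise domination, the per-term analytic
inputs of Lemmas 1–2, identifications, numbers. [cite: Balaban1988RG2Cluster, Lemmas 1–3 pp.9, 11, 20; (2.14)–(2.26) pp.15–17] -/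
theorem b13Leaf_twoTorus_primitives
    (Wt : TwoTorusStep 4 L N') (c : B13.Consts) (k : ℕ) (hN12 : 12 ≤ L * N') (hL8 : 8 ≤ c.L) (hLc : c.L = L)
    -- (1) LEMMA 1: index data of (1.33)
    (S0 : TDom 4 (L * N') → Finset (TPt 4 (L * N')))
    (F : TDom 4 (L * N') → TPt 4 (L * N') → Finset (TPt 4 (L * N')))
    (Sq : TDom 4 (L * N') → TPt 4 (L * N') → (j : ℕ) → Finset (TPt 4 (L ^ (k - j) * (L * N'))))
    (SX : TDom 4 (L * N') → TPt 4 (L * N') → (j : ℕ) → TPt 4 (L ^ (k - j) * (L * N')) →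
      Finset (TDom 4 (L ^ (k - j) * (L * N'))))
    (T : TDom 4 (L * N') → TPt 4 (L * N') → Finset (TPt 4 (L * N')) → (j : ℕ) →
      TPt 4 (L ^ (k - j) * (L * N')) → TDom 4 (L ^ (k - j) * (L * N')) → Wt.Φ → ℂ)
    (Sc : TDom 4 (L * N') → Finset (TPt 4 (L * N')))
    (Sq' : TDom 4 (L * N') → TPt 4 (L * N') → (j : ℕ) → Finset (TPt 4 (L ^ (k - j) * (L * N'))))
    (SX' : TDom 4 (L * N') → TPt 4 (L * N') → (j : ℕ) → TPt 4 (L ^ (k - j) * (L * N')) →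
      Finset (TDom 4 (L ^ (k - j) * (L * N'))))
    (T' : TDom 4 (L * N') → TPt 4 (L * N') → (j : ℕ) → TPt 4 (L ^ (k - j) * (L * N')) →
      TDom 4 (L ^ (k - j) * (L * N')) → Wt.Φ → ℂ)
    (dist : TDom 4 (L * N') → TPt 4 (L * N') → (j : ℕ) → TPt 4 (L ^ (k - j) * (L * N')) → ℝ) {K K' : ℝ}
    (h133 : ∀ Y, Wt.Vp Y =
      (∑ a ∈ S0 Y, ∑ X ∈ (F Y a).powerset, ∑ j ∈ Finset.range (k + 1), ∑ q ∈ Sq Y a j,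
        ∑ x ∈ SX Y a j q, T Y a X j q x) +
      (∑ a ∈ Sc Y, ∑ j ∈ Finset.range (k + 1), ∑ q ∈ Sq' Y a j, ∑ x ∈ SX' Y a j q, T' Y a j q x))
    (hS0Y : ∀ Y, ∀ a ∈ S0 Y,
      (pbox (fun i => natLift a i - (5 : ℕ)) (fun i => natLift a i + 1 + (5 : ℕ))).image (proj (L * N')) ⊆ Y.1)
    (hFsub : ∀ Y a, F Y a ⊆
      (pbox (fun i => natLift a i - (5 : ℕ)) (fun i => natLift a i + 1 + (5 : ℕ))).image (proj (L * N')) \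
        (pbox (fun i => natLift a i - (4 : ℕ)) (fun i => natLift a i + 1 + (4 : ℕ))).image (proj (L * N')))
    (hSq : ∀ Y, ∀ a ∈ S0 Y, ∀ j, Sq Y a j ⊆ (Finset.univ : Finset (TPt 4 (L ^ (k - j) * (L * N')))).filter
      (fun q => tcoarse (L ^ (k - j)) (L * N') q ∈
        (pbox (fun i => natLift a i - (2 : ℕ)) (fun i => natLift a i + 1 + (2 : ℕ))).image (proj (L * N'))))
    (hScY : ∀ Y, Sc Y ⊆ Y.1)
    (hdist0 : ∀ Y a j q, 0 ≤ c.δ₀ * dist Y a j q)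
    (hdist : ∀ Y a j (n : ℕ) q, q ∉ (pbox (fun i => ((L ^ (k - j) : ℕ) : ℤ) * natLift a i - (n + 1 : ℕ))
      (fun i => ((L ^ (k - j) : ℕ) : ℤ) * natLift a i + 2 * ((L ^ (k - j) : ℕ) : ℤ) - 1 + (n + 1 : ℕ))).image
        (proj (L ^ (k - j) * (L * N'))) → c.δ₀ * c.M * ((n : ℝ) + 1) ≤ c.δ₀ * dist Y a j q)
    (hSX : ∀ Y a j q, SX Y a j q ⊆ (tcubeSys 4 (L ^ (k - j) * (L * N'))).above q)
    (hSX' : ∀ Y a j q, SX' Y a j q ⊆ (tcubeSys 4 (L ^ (k - j) * (L * N'))).above q)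
    (hX0 : ∀ Y, ∀ a ∈ Sc Y, ∀ j ∈ Finset.range (k + 1), ∀ q ∈ Sq' Y a j, ∀ x ∈ SX' Y a j q,
      x.1.image (tcoarse (L ^ (k - j)) (L * N')) ⊆ Y.1)
    -- (1) LEMMA 1: analyticity of the terms, closure of `Analytic`
    (hAdd : ∀ (s : Set Wt.Φ) (f g : Wt.Φ → ℂ), Wt.Analytic f s → Wt.Analytic g s → Wt.Analytic (f + g) s)
    (hZero : ∀ s : Set Wt.Φ, Wt.Analytic 0 s)
    (hAnT : ∀ Y, ∀ a ∈ S0 Y, ∀ X ∈ (F Y a).powerset, ∀ j ∈ Finset.range (k + 1), ∀ q ∈ Sq Y a j,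
      ∀ x ∈ SX Y a j q, Wt.Analytic (T Y a X j q x) (Wt.sp1 Y))
    (hAnT' : ∀ Y, ∀ a ∈ Sc Y, ∀ j ∈ Finset.range (k + 1), ∀ q ∈ Sq' Y a j, ∀ x ∈ SX' Y a j q,
      Wt.Analytic (T' Y a j q x) (Wt.sp1 Y))
    -- (1) LEMMA 1: thresholds and restrictions
    (hK : 0 ≤ K) (hK' : 0 ≤ K') (hκ : 0 ≤ c.κ) (hδ1 : c.δ < 1) (hδκ : 1 ≤ c.δ * c.κ)
    (hκ126 : kappa₀ 64 8 ≤ c.κ) (hκ126' : kappa₀ 64 8 ≤ c.δ * c.κ)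
    (hκ₁ : 1 + 2 * Real.log (8 * 12 ^ 3) ≤ c.κ₁) (hκ₁' : 2 + 16 * Real.log 128 ≤ c.κ₁)
    (hδ₀M : 10 * Real.exp (-1) ≤ c.δ₀ * c.M) (hδ₀M5 : 2 * Real.log 5 ≤ c.δ₀ * c.M)
    (hR8 : (1 - c.δ) * c.κ ≤ (1 / 4) * (c.κ₁ - 1)) (hR9 : (1 - 2 * c.δ) * c.κ ≤ (1 / 16) * c.κ₁)
    -- (1) LEMMA 1: per-term (1.24), (1.30); the constants of (1.36) with headroom (1 − θ) for the local pieces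
    (h124 : ∀ Y φ, φ ∈ Wt.sp1 Y → ∀ a ∈ S0 Y, ∀ X ∈ (F Y a).powerset, ∀ j ∈ Finset.range (k + 1), ∀ q ∈ Sq Y a j,
      ∀ x ∈ SX Y a j q,
        ‖T Y a X j q x φ‖ ≤ K * ((L : ℝ) ^ j * ((L : ℝ) ^ k)⁻¹) ^ 5 *
          Real.exp (-(c.κ₁ - 1) *
            (((Y.1 \ (pbox (fun i => natLift a i - (5 : ℕ)) (fun i => natLift a i + 1 + (5 : ℕ))).image
              (proj (L * N'))).card : ℝ) + X.card)) *
          Real.exp (-(c.κ * torusTreeLen x.1)))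
    (h130 : ∀ Y φ, φ ∈ Wt.sp1 Y → ∀ a ∈ Sc Y, ∀ j ∈ Finset.range (k + 1), ∀ q ∈ Sq' Y a j,
      ∀ x ∈ SX' Y a j q,
        ‖T' Y a j q x φ‖ ≤ K' * Real.exp (-(1 / 2) * (c.δ₀ * c.M) * ((L : ℝ) ^ j * ((L : ℝ) ^ k)⁻¹)⁻¹
            - (1 / 2) * c.δ₀ * dist Y a j q) *
          Real.exp (-(c.κ₁ - 1) * ((Y.1 \ x.1.image (tcoarse (L ^ (k - j)) (L * N'))).card : ℝ)) *
          Real.exp (-(c.κ * torusTreeLen x.1)))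
    {θ : ℝ} (hθ0 : 0 ≤ θ) (hθ1 : θ < 1)
    (hC : K * K₀ 64 8 * (2 * (6 * (L : ℝ)) ^ 4) * Real.exp 1 * Real.exp ((1 / 8) * c.κ₁ * (12 ^ 4 - 1)) +
        2 * (64 * K') * K₀ 64 8 * 1344 ≤
      (1 - θ) * (c.E₀ * c.ε₁ * c.C₁ * c.M ^ c.q * Real.exp (c.C₂ * c.κ₁)))
    -- (2) LEMMA 2 (pp. 10–11): V″_k = V′_k + the local pieces G of P^{(k)}, analytic and (1.36)-small at prefactor θ
    (Gl : TDom 4 (L * N') → Wt.Φ → ℂ) (hVpp : ∀ Y, Wt.Vpp Y = fun φ => Wt.Vp Y φ + Gl Y φ)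
    (hGlAn : ∀ Y, Wt.Analytic (Gl Y) (Wt.sp1 Y))
    (hGl : ∀ Y φ, φ ∈ Wt.sp1 Y → ‖Gl Y φ‖ ≤ θ * (c.E₀ * c.ε₁ * c.C₁ * c.M ^ c.q * Real.exp (c.C₂ * c.κ₁)) *
      Real.exp (-((1 - 2 * c.δ) * c.κ * (tsys 4 (L * N')).dj Y)))
    -- (2) LEMMA 2: the located per-term data of `B13Lemma2Torus.lemma2Printed_twoTorus'`
    {E : Type*} [NormedAddCommGroup E] [NormedSpace ℂ E]
    (rd : TDom 4 (L * N') → Wt.Φ → E) (e : TDom 4 (L * N') → Wt.Bond → E) (he : ∀ Y b, ‖e Y b‖ ≤ 1)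
    (hrd : ∀ Y φ, rd Y φ = haveI := Wt.finBond; ∑ b, Wt.Bv φ b • e Y b)
    {ι₂ : Type*} (s : TDom 4 (L * N') → Finset ι₂) (Wf : TDom 4 (L * N') → ι₂ → Wt.Φ → E → ℂ) {g : ℂ} (hg : g ≠ 0)
    {R K₂ : ℝ} {m₂ : ℕ} (hK₂ : 0 ≤ K₂) (hR : 0 < R) (h3 : 3 * c.ε₁ ≤ R)
    (hW : ∀ Y, ∀ i ∈ s Y, ∀ φ ∈ Wt.sp1 Y, AnalyticOnNhd ℂ (Wf Y i φ) (ball 0 R))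
    (hKW : ∀ Y, ∀ i ∈ s Y, ∀ φ ∈ Wt.sp1 Y, ∀ z ∈ ball (0 : E) R,
      ‖Wf Y i φ z‖ ≤ K₂ * Real.exp (-(c.κ₁ - 1) * ((Y.1.card : ℝ) - 1)) * ‖z‖ ^ 3)
    (hcard : ∀ Y, (s Y).card ≤ m₂ * Y.1.card)
    (hV : ∀ Y, Wt.V Y = fun φ => (∑ i ∈ s Y, scaled g (Wf Y i φ) (rd Y φ)) + Wt.Vpp Y φ)
    (hQ : ∀ Y φ (b b' : Wt.Bond), φ ∈ Wt.sp1 Y →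
      Wt.Q Y φ b b' = 2 * ∑ i ∈ s Y, Qop (scaled g (Wf Y i φ)) (rd Y φ) (e Y b) (e Y b'))
    (hsp : ∀ Y φ, φ ∈ Wt.sp1 Y → ‖g‖ * ‖rd Y φ‖ < c.ε₁)
    (hvolk : ∀ Y, Wt.volk Y = Y.1.card)
    (hfloor : 27 * m₂ * K₂ * Real.exp (c.κ₁ - 1) ≤ c.C₃ * c.M ^ 4 * Real.exp (c.C₂ * c.κ₁))
    (hAnP : ∀ Y, ∀ i ∈ s Y, Wt.Analytic (fun φ => scaled g (Wf Y i φ) (rd Y φ)) (Wt.sp1 Y))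
    (hG : ∀ Y, Wt.GaugeInv (Wt.V Y) ∧ Wt.GaugeInv (Wt.toStepData.quadForm Y) ∧ Wt.GaugeInv (Wt.Vpp Y))
    -- (3) LEMMA 3 (pp. 14–20): the signs of (2.18)–(2.20), R12, |τ(Y)| ≥ 2, and the numerics bundle at ℓ = ½L
    (M₃ : ℕ) [NeZero M₃] {a a₂ a₂' a₅ Aabs : ℝ} (hN : Lemma3Numerics c M₃ ((c.L : ℝ) / 2) a a₂ a₂' a₅ Aabs)
    (h12 : R12 c) (hE : 0 < c.E₀) (hε : 0 < c.ε₁) (hC₁ : 0 < c.C₁) (hα : 0 < c.α₄) (hM : 1 ≤ c.M)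
    (hτ2 : c.E₀ * c.ε₁ * c.C₁ * c.α₄⁻¹ * c.M ^ c.q * Real.exp (c.C₂ * c.κ₁) ≤ 1 / 2)
    -- (3) the Cauchy radius and the parameter domains (p. 15)
    {Uσ Uτ : Set ℂ} (hUσ : IsOpen Uσ) (hUτ : IsOpen Uτ) (hUexp : Metric.closedBall (0 : ℂ) (Real.exp c.κ₁) ⊆ Uσ)
    (hUtau : ∀ Y : TDom 4 (L * N'), Metric.closedBall (0 : ℂ) ((invTau c ((tsys 4 (L * N')).dj Y))⁻¹) ⊆ Uτ)
    {r : ℝ} (hr : 0 < r) (hr' : r ≤ Real.exp c.κ₁ - 1)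
    (hsubτ : ∀ x ∈ Set.uIcc (0 : ℝ) 1, Metric.closedBall (x : ℂ) r ⊆ Uτ)
    -- (3) per term (𝐃, P) of every Z ∈ 𝐃_{k+1}: index types, parameter lists, kernels, characteristic functions, potentials
    (Λ C₀ : TDom 4 N' → Finset (TDom 4 (L * N')) × Finset (TBond 4 M₃ (L * N')) → Type)
    [∀ Z t, Fintype (Λ Z t)] [∀ Z t, DecidableEq (Λ Z t)] [∀ Z t, Fintype (C₀ Z t)] [∀ Z t, DecidableEq (C₀ Z t)]
    (lZ : TDom 4 N' → Finset (TDom 4 (L * N')) × Finset (TBond 4 M₃ (L * N')) → List (TPt 4 N'))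
    (hlZ : ∀ Z, ∀ t ∈ terms L M₃ Z, (lZ Z t).Nodup ∧ (lZ Z t).toFinset = Z.1 \ tclosure L N' (Z0 M₃ t))
    (lD : TDom 4 N' → Finset (TDom 4 (L * N')) × Finset (TBond 4 M₃ (L * N')) → List (TDom 4 (L * N')))
    (hlD : ∀ Z, ∀ t ∈ terms L M₃ Z, (lD Z t).Nodup ∧ (lD Z t).toFinset = t.1)
    (Am : (Z : TDom 4 N') → (t : Finset (TDom 4 (L * N')) × Finset (TBond 4 M₃ (L * N'))) → Wt.Φ →
      (TPt 4 N' → ℂ) → Matrix (Λ Z t) (Λ Z t) ℂ)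
    (Γm : (Z : TDom 4 N') → (t : Finset (TDom 4 (L * N')) × Finset (TBond 4 M₃ (L * N'))) → Wt.Φ →
      (TPt 4 N' → ℂ) → (Λ Z t ⊕ C₀ Z t → ℝ) → (Λ Z t → ℂ))
    (χY₀ χcP : (Z : TDom 4 N') → (t : Finset (TDom 4 (L * N')) × Finset (TBond 4 M₃ (L * N'))) → (Λ Z t → ℝ) → ℝ)
    (hχ0 : ∀ Z t B, 0 ≤ χY₀ Z t B) (hχ1 : ∀ Z t B, χY₀ Z t B ≤ 1)
    (Pl : (Z : TDom 4 N') → (t : Finset (TDom 4 (L * N')) × Finset (TBond 4 M₃ (L * N'))) → Finset (Λ Z t))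
    (hPcard : ∀ Z, ∀ t ∈ terms L M₃ Z, (Pl Z t).card = t.2.card) {rP : ℝ} (hrP : 0 ≤ rP)
    (hχc : ∀ Z t B, χcP Z t B = ∏ b ∈ Pl Z t, (if rP ≤ |B b| then (1 : ℝ) else 0))
    (Dfam : TDom 4 N' → Finset (TDom 4 (L * N')) × Finset (TBond 4 M₃ (L * N')) → Finset (TDom 4 (L * N')))
    (Vr : (Z : TDom 4 N') → (t : Finset (TDom 4 (L * N')) × Finset (TBond 4 M₃ (L * N'))) → Wt.Φ →
      TDom 4 (L * N') → (Λ Z t → ℝ) → ℂ)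
    -- (3) termwise domination: ‖H(Z)‖ ≤ Σ_{(𝐃,P)} ‖(2.14)‖ on the space of p. 15 ((2.9)/(2.14))
    (hH : ∀ (Z : TDom 4 N') (φ : Wt.Φ), φ ∈ Wt.sp2 Z → ‖Wt.H Z φ‖ ≤
      ∑ t ∈ terms L M₃ Z, ‖term214 r (lZ Z t) (lD Z t)
        (core214 (Am Z t φ) (Γm Z t φ) (F214 t.2.card (χY₀ Z t) (χcP Z t) (Dfam Z t) (Vr Z t φ))) 0 0‖)
    -- (3) the record's objects behind the terms: bonds, cubes, the real field inside the configurations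
    (ιb : (Z : TDom 4 N') → (t : Finset (TDom 4 (L * N')) × Finset (TBond 4 M₃ (L * N'))) → Λ Z t → Wt.Bond)
    (hι : ∀ Z t, Function.Injective (ιb Z t)) (cube : Wt.Bond → TPt 4 (L * N'))
    (hQsupp : ∀ (Y : TDom 4 (L * N')) φ b b', Wt.Q Y φ b b' ≠ 0 → cube b ∈ Y.1 ∧ cube b' ∈ Y.1)
    {m' : ℕ} (hfibc : ∀ Z t (x : TPt 4 (L * N')), (Finset.univ.filter fun j => cube (ιb Z t j) = x).card ≤ m')
    (emb : (Z : TDom 4 N') → (t : Finset (TDom 4 (L * N')) × Finset (TBond 4 M₃ (L * N'))) → Wt.Φ →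
      (Λ Z t → ℝ) → Wt.Φ)
    (hBv : ∀ Z t φ B b, Wt.Bv (emb Z t φ B) (ιb Z t b) = (B b : ℂ))
    (hBv0 : ∀ Z t φ B b', b' ∉ Set.range (ιb Z t) → Wt.Bv (emb Z t φ B) b' = 0)
    (hVr : ∀ Z, ∀ t ∈ terms L M₃ Z, ∀ φ ∈ Wt.sp2 Z, ∀ Y ∈ Dfam Z t, ∀ B,
      emb Z t φ B ∈ Wt.sp1 Y → Vr Z t φ Y B = Wt.V Y (emb Z t φ B))
    (hχsupp : ∀ Z, ∀ t ∈ terms L M₃ Z, ∀ φ ∈ Wt.sp2 Z, ∀ B, χY₀ Z t B ≠ 0 → ∀ Y ∈ Dfam Z t,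
      emb Z t φ B ∈ Wt.sp1 Y)
    -- (3) separate holomorphy of the X-integral in (σ, τ)
    (hΨσ : ∀ Z, ∀ t ∈ terms L M₃ Z, ∀ φ ∈ Wt.sp2 Z, ∀ τ : TDom 4 (L * N') → ℂ, (∀ j, τ j ∈ Uτ) →
      SepHolOn Uσ (fun σ => core214 (Am Z t φ) (Γm Z t φ)
        (F214 t.2.card (χY₀ Z t) (χcP Z t) (Dfam Z t) (Vr Z t φ)) σ τ))
    (hΨτ : ∀ Z, ∀ t ∈ terms L M₃ Z, ∀ φ ∈ Wt.sp2 Z, ∀ σ : TPt 4 N' → ℂ, (∀ j, σ j ∈ Uσ) →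
      SepHolOn Uτ (fun τ => core214 (Am Z t φ) (Γm Z t φ)
        (F214 t.2.card (χY₀ Z t) (χcP Z t) (Dfam Z t) (Vr Z t φ)) σ τ))
    -- (3) the reference covariance, Γ₀, the kernels of Γ(σ)
    (Cm : (Z : TDom 4 N') → (t : Finset (TDom 4 (L * N')) × Finset (TBond 4 M₃ (L * N'))) → Wt.Φ →
      Matrix (Λ Z t) (Λ Z t) ℝ)
    (Γ₀m : (Z : TDom 4 N') → (t : Finset (TDom 4 (L * N')) × Finset (TBond 4 M₃ (L * N'))) → Wt.Φ →
      Matrix (Λ Z t) (Λ Z t ⊕ C₀ Z t) ℝ)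
    (Gm : (Z : TDom 4 N') → (t : Finset (TDom 4 (L * N')) × Finset (TBond 4 M₃ (L * N'))) → Wt.Φ →
      (TPt 4 N' → ℂ) → Matrix (Λ Z t) (Λ Z t ⊕ C₀ Z t) ℂ)
    (hAs : ∀ Z, ∀ t ∈ terms L M₃ Z, ∀ φ ∈ Wt.sp2 Z, ∀ σ : TPt 4 N' → ℂ, (∀ j, ‖σ j‖ ≤ Real.exp c.κ₁) →
      (Am Z t φ σ).IsSymm)
    (hA : ∀ Z, ∀ t ∈ terms L M₃ Z, ∀ φ ∈ Wt.sp2 Z, ∀ σ : TPt 4 N' → ℂ, (∀ j, ‖σ j‖ ≤ Real.exp c.κ₁) →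
      ((Am Z t φ σ).map Complex.re).PosDef)
    (hlin : ∀ Z, ∀ t ∈ terms L M₃ Z, ∀ φ ∈ Wt.sp2 Z, ∀ σ : TPt 4 N' → ℂ, (∀ j, ‖σ j‖ ≤ Real.exp c.κ₁) →
      ∀ X : Λ Z t ⊕ C₀ Z t → ℝ, Γm Z t φ σ X = Gm Z t φ σ *ᵥ fun j => (X j : ℂ))
    {γ₂ : ℝ} (hγ₂ : 0 ≤ γ₂)
    -- (3) the bonds located on a site torus (for the kernel letters)
    {ν : ℕ} {Nf : Fin ν → ℕ} [∀ i, NeZero (Nf i)]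
    (locΛ : (Z : TDom 4 N') → (t : Finset (TDom 4 (L * N')) × Finset (TBond 4 M₃ (L * N'))) → Λ Z t → UT Nf)
    (locN : (Z : TDom 4 N') → (t : Finset (TDom 4 (L * N')) × Finset (TBond 4 M₃ (L * N'))) →
      Λ Z t ⊕ C₀ Z t → UT Nf) {m : ℕ}
    (hfibΛ : ∀ Z t (x : UT Nf), (Finset.univ.filter fun i => locΛ Z t i = x).card ≤ m)
    (hfibN : ∀ Z t (x : UT Nf), (Finset.univ.filter fun j => locN Z t j = x).card ≤ m)
    -- (3) rates and constants
    {kap kap' kap'' ϑ θE θΓ θC KG KΓ KCs K₀' : ℝ} (hkap'' : 0 < kap'') (hk1 : kap'' < kap') (hk2 : kap' < kap)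
    (hθE : 0 ≤ θE) (hθΓ : 0 ≤ θΓ) (hθC : 0 ≤ θC) (hKG : 0 ≤ KG) (hKΓ : 0 ≤ KΓ) (hKCs : 0 ≤ KCs) (hK₀' : 0 ≤ K₀')
    (hθEle : θE ≤ ϑ) (hθΓle : θΓ ≤ ϑ)
    (hθR1le : (m * (1 + 2 / (kap - kap')) ^ ν) * (m * (1 + 2 / (kap' - kap'')) ^ ν)
      * (θΓ * KCs * KG + KΓ * θC * KG + KΓ * K₀' * θΓ) ≤ ϑ)
    -- (3) uniform localisation of the primitive kernels in the torus distance (L17a)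
    (hGb : ∀ Z, ∀ t ∈ terms L M₃ Z, ∀ φ ∈ Wt.sp2 Z, ∀ σ : TPt 4 N' → ℂ, (∀ j, ‖σ j‖ ≤ Real.exp c.κ₁) →
      ∀ b j, ‖Gm Z t φ σ b j‖ ≤ KG * Real.exp (-(kap * tdist1 Nf (locΛ Z t b) (locN Z t j))))
    (hΓ₀b : ∀ Z, ∀ t ∈ terms L M₃ Z, ∀ φ ∈ Wt.sp2 Z,
      ∀ b j, ‖Γ₀m Z t φ b j‖ ≤ KΓ * Real.exp (-(kap * tdist1 Nf (locΛ Z t b) (locN Z t j))))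
    (hCs : ∀ Z, ∀ t ∈ terms L M₃ Z, ∀ φ ∈ Wt.sp2 Z, ∀ σ : TPt 4 N' → ℂ, (∀ j, ‖σ j‖ ≤ Real.exp c.κ₁) →
      ∀ b b', ‖(Am Z t φ σ)⁻¹ b b'‖ ≤ KCs * Real.exp (-(kap * tdist1 Nf (locΛ Z t b) (locΛ Z t b'))))
    (hC216 : ∀ Z, ∀ t ∈ terms L M₃ Z, ∀ φ ∈ Wt.sp2 Z,
      ∀ b b', ‖Cm Z t φ b b'‖ ≤ K₀' * Real.exp (-(kap * tdist1 Nf (locΛ Z t b) (locΛ Z t b'))))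
    -- (3) the (2.16)-type differences of the primitive kernels in the torus distance (L16a)
    (hdΓ : ∀ Z, ∀ t ∈ terms L M₃ Z, ∀ φ ∈ Wt.sp2 Z, ∀ σ : TPt 4 N' → ℂ, (∀ j, ‖σ j‖ ≤ Real.exp c.κ₁) →
      ∀ b j, ‖(Gm Z t φ σ - (Γ₀m Z t φ).map (algebraMap ℝ ℂ)) b j‖ ≤
        θΓ * Real.exp (-(kap * tdist1 Nf (locΛ Z t b) (locN Z t j))))
    (hdC : ∀ Z, ∀ t ∈ terms L M₃ Z, ∀ φ ∈ Wt.sp2 Z, ∀ σ : TPt 4 N' → ℂ, (∀ j, ‖σ j‖ ≤ Real.exp c.κ₁) →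
      ∀ b b', ‖((Am Z t φ σ)⁻¹ - (Cm Z t φ).map (algebraMap ℝ ℂ)) b b'‖ ≤
        θC * Real.exp (-(kap * tdist1 Nf (locΛ Z t b) (locΛ Z t b'))))
    (hdE : ∀ Z, ∀ t ∈ terms L M₃ Z, ∀ φ ∈ Wt.sp2 Z, ∀ σ : TPt 4 N' → ℂ, (∀ j, ‖σ j‖ ≤ Real.exp c.κ₁) →
      ∀ b b', ‖(Am Z t φ σ - (Cm Z t φ)⁻¹.map (algebraMap ℝ ℂ)) b b'‖ ≤
        θE * Real.exp (-(kap * tdist1 Nf (locΛ Z t b) (locΛ Z t b'))))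
    (hsmallKθ : K₀' * (m * (1 + 2 / kap) ^ ν) * (ϑ * (m * (1 + 2 / kap'') ^ ν)) < 1)
    -- (3) the (2.24)–(2.25) smallness with `a₂₀ = m′·α₄·M⁻⁴(1 + 32/(κ₁−1))⁴`, norms of C and Γ₀
    {cE gq : ℝ} (hc0 : 0 ≤ cE)
    (hCq : ∀ Z, ∀ t ∈ terms L M₃ Z, ∀ φ ∈ Wt.sp2 Z, ∃ hC : (Cm Z t φ).PosDef, ∀ i, hC.1.eigenvalues i ≤ cE)
    (hαc : (2 * (ϑ * (m * (1 + 2 / kap'') ^ ν)) +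
      (γ₂ + m' * c.α₄ * (c.M ^ 4)⁻¹ * (1 + 32 / (c.κ₁ - 1)) ^ 4)) * cE ≤ 1 / 2) (hgq : 0 ≤ gq)
    (hΓq : ∀ Z, ∀ t ∈ terms L M₃ Z, ∀ φ ∈ Wt.sp2 Z, ∀ X : Λ Z t ⊕ C₀ Z t → ℝ,
      (Γ₀m Z t φ *ᵥ X) ⬝ᵥ (Cm Z t φ *ᵥ (Γ₀m Z t φ *ᵥ X)) ≤ gq * (X ⬝ᵥ X))
    (hsmall : (2 * (ϑ * (m * (1 + 2 / kap'') ^ ν)) +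
      (γ₂ + m' * c.α₄ * (c.M ^ 4)⁻¹ * (1 + 32 / (c.κ₁ - 1)) ^ 4)) * (1 + 2 * cE * gq) ≤ 1 / 2)
    -- (3) constant matching, p. 17: `a ≤ γ₂ r_P²` and the volume factor with `w = K₀(64,8)·α₄·#(⋃𝐃)`
    (hPa : a ≤ γ₂ * rP ^ 2)
    (hvol : ∀ Z, ∀ t ∈ terms L M₃ Z,
      2 * (K₀' * (m * (1 + 2 / kap) ^ ν) * (ϑ * (m * (1 + 2 / kap'') ^ ν))
              * (1 + (1 - K₀' * (m * (1 + 2 / kap) ^ ν) * (ϑ * (m * (1 + 2 / kap'') ^ ν)))⁻¹) / 2)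
          * (Fintype.card (Λ Z t) : ℝ)
        + K₀ 64 8 * c.α₄ * ((((Dfam Z t).image Subtype.val).biUnion id).card : ℝ)
        + (2 * (ϑ * (m * (1 + 2 / kap'') ^ ν)) +
            (γ₂ + m' * c.α₄ * (c.M ^ 4)⁻¹ * (1 + 32 / (c.κ₁ - 1)) ^ 4)) * cE * (Fintype.card (Λ Z t) : ℝ)
        + (2 * (ϑ * (m * (1 + 2 / kap'') ^ ν)) +
            (γ₂ + m' * c.α₄ * (c.M ^ 4)⁻¹ * (1 + 32 / (c.κ₁ - 1)) ^ 4)) * (1 + 2 * cE * gq)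
            * (Fintype.card (Λ Z t ⊕ C₀ Z t) : ℝ)
        ≤ a₅ * ((Z.1).card : ℝ)) :
    B13.Lemma1Printed Wt.toStepData c ∧ B13.Lemma2Printed Wt.toStepData c ∧ B13.Lemma3Printed Wt.toStepData c := by
  -- the thresholds of (2.18)–(2.20) from Lemma 1's; C₃ ≥ 0 from the floor; |τ(Y)|⁻¹ ∈ ]0, ½]
  have hκ₁B : 1 + 4 * Real.log 162 ≤ c.κ₁ := binders_kappa1_of_R7 hκ₁'
  have hκ₁1 : 1 ≤ c.κ₁ := one_le_kappa1_of_R7 hκ₁'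
  have hδκB : 64 * Real.log 162 ≤ c.δ * c.κ := binders_deltaKappa_of_126 hκ126'
  have hM0 : 0 < c.M := lt_of_lt_of_le one_pos hM
  have hC₃ : 0 ≤ c.C₃ := C3_nonneg_of_floor c hK₂ hM0 hfloor
  have hpos : ∀ Y : TDom 4 (L * N'), 0 < invTau c ((tsys 4 (L * N')).dj Y) := fun Y =>
    invTau_pos c hE hε hC₁ hα hM0 _
  have hδ3 : 0 ≤ 1 - 3 * c.δ :=
    hN.hδ7.trans (sub_le_sub_left (mul_le_mul_of_nonneg_right (by norm_num) hN.hδ) 1)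
  have hpre : 0 ≤ c.E₀ * c.ε₁ * c.C₁ * c.α₄⁻¹ * c.M ^ c.q * Real.exp (c.C₂ * c.κ₁) :=
    mul_nonneg (mul_nonneg (mul_nonneg (mul_nonneg (mul_nonneg hE.le hε.le) hC₁.le) (inv_nonneg.2 hα.le))
      (pow_nonneg hM0.le _)) (Real.exp_nonneg _)
  have hhalf : ∀ Y : TDom 4 (L * N'), invTau c ((tsys 4 (L * N')).dj Y) ≤ 1 / 2 := fun Y =>
    invTau_le_half c hδ3 hκ hpre hτ2 ((tsys 4 (L * N')).dj_nonneg Y)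
  have hL2 : 2 ≤ L := by rw [← hLc]; exact le_trans (by norm_num) hL8
  -- Lemma 1 and Lemma 2 from their located inputs (for the capstone's Lemma-2 binders)
  have h12L := lemma12_twoTorus Wt c k hN12 hL2 S0 F Sq SX T Sc Sq' SX' T' dist h133 hS0Y hFsub hSq hScY hdist0 hdist hSX hSX' hX0 hAdd hZero hAnT hAnT' hK hK' hκ hδ1 hδκ hκ126 hκ126' hκ₁ hκ₁' hδ₀M hδ₀M5 hR8 hR9 h124 h130 hθ0 hθ1 hC
    Gl hVpp hGlAn hGl rd e he hrd s Wf hg hK₂ hR h3 hW hKW hcard hV hQ hsp hvolk hfloor hAnP hG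
  have h2 : B13.Lemma2Printed Wt.toStepData c := h12L.2
  -- (2.26) per term from the primitives, the Lemma-2 binders discharged by `h2`
  have h226 : Termwise226 c a a₅ Wt (fun Z t φ => term214 r (lZ Z t) (lD Z t)
      (core214 (Am Z t φ) (Γm Z t φ) (F214 t.2.card (χY₀ Z t) (χcP Z t) (Dfam Z t) (Vr Z t φ))) 0 0) := by
    intro Z φ hφ t ht
    obtain ⟨hCpd, hcE⟩ := hCq Z t ht φ hφ
    exact h226_torus_of_primitives_of_lemma2 c hκ₁1 hN.hα₆.ne' Wt h2.2.1 h2.2.2.1 h2.2.2.2.1 hvolk h12 hC₃ hE hε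
      hC₁ hα hM hκ₁B hδκB Z t hpos hhalf hUσ hUτ hUexp hUtau hr hr' hsubτ (lZ Z t) (hlZ Z t ht) (lD Z t)
      (hlD Z t ht) (Am Z t φ) (Γm Z t φ) (χY₀ Z t) (χcP Z t) (hχ0 Z t) (hχ1 Z t) (Pl Z t) (hPcard Z t ht) hrP
      (hχc Z t) (Dfam Z t) (Vr Z t φ) (ιb Z t) (hι Z t) cube hQsupp (hfibc Z t) (emb Z t φ) (hBv Z t φ)
      (hBv0 Z t φ) (hVr Z t ht φ hφ) (hχsupp Z t ht φ hφ) (hΨσ Z t ht φ hφ) (hΨτ Z t ht φ hφ) hCpd (Γ₀m Z t φ)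
      (hAs Z t ht φ hφ) (hA Z t ht φ hφ) (Gm Z t φ) (hlin Z t ht φ hφ) hγ₂ (locΛ Z t) (locN Z t) (hfibΛ Z t)
      (hfibN Z t) hkap'' hk1 hk2 hθE hθΓ hθC hKG hKΓ hKCs hK₀' hθEle hθΓle hθR1le (hGb Z t ht φ hφ)
      (hΓ₀b Z t ht φ hφ) (hCs Z t ht φ hφ) (hC216 Z t ht φ hφ) (hdΓ Z t ht φ hφ) (hdC Z t ht φ hφ)
      (hdE Z t ht φ hφ) hsmallKθ hc0 hcE hαc hgq (hΓq Z t ht φ hφ) hsmall hPa (hvol Z t ht)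
  -- Lemma 3: (2.38) at ℓ = ½L from the termwise (2.26), termwise domination and the numbers
  have h236 : B13.Ineq236With (tsys 4 (L * N')) (tsys 4 N') (tclosureDom L N') ((c.L : ℝ) / 2) := by
    rw [hLc]
    exact ineq236Printed_torus (d := 4) L N' (hLc ▸ hL8)
  have h238 : B13.Bound238 Wt.toStepData c :=
    (B13.bound238With_half Wt.toStepData c).1
      (bound238With_of_hRep c hLc Wt M₃ hN h236 (hRep_of_termwise c (mul_nonneg hN.hα₆.le hN.hε₀) Wt _ hH h226))
  exact ⟨h12L.1, h2, fun _ => h238⟩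

end Primitives

end Literature.MathematicalPhysics.QuantumFieldTheory.Balaban1983to89.B13NodeTorusTermwise

end
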